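import Literature.Computability.AlgebraicComplexity.DDS21ShiftInitialForms
import Literature.Computability.AlgebraicComplexity.DDS21DiDILStep
import HarnessLib

/-!
# Dutta–Dwivedi–Saxena 2021, §3: the COMPANION INVARIANT of the DiDIL transcript at the generic point
# (brick B4c (E4.4): `x`-weights of the DiDIL data, and the stage models of Claim 3.8)

Theorem-and-definition companion (cell `val-lit`, np lane, DDS21 Thm 3.2 programme "M-b", lead-np
RULINGS (143)(b) `(A′)`, (147)(b), (149)(d); design line HOME bus 2026-08-27 20:08Z) for P. Dutta,
P. Dwivedi, N. Saxena, *Demystifying the border of depth-3 algebraic circuits*, FOCS 2021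
[DuttaDwivediSaxena2022], held full version `paper:galaxy-pdf-7641649743695546420` (chunk
`pNNNN.txt`, printed line `Lnnn`).

## What is proved

The printed DiDIL induction keeps, for every bloated term `T_{i,j} = (U/V)·(P/Q)`, the hypothesis
"`v_{i,j} := val_z(T_{i,j}) ≥ 0` … Moreover `U_{i,j}|_{z=0} ∈ F(ε)∖{0}`" (p0030 L804–805) and uses,
in Claim 3.8, that "`g_j/T̃_{k−j,j} = Σ_i T_{i,j}/T̃_{k−j,j} ∈ F(x)[[z,ε]]`, as the valuation with
respect to `z` and `ε` is non-negative" so that `(f_j/t_{k−j,j})|_{z=0} = lim_{ε→0} Σ_i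
(T_{i,j}/T̃_{k−j,j})|_{z=0}` (p0035 L934–939). In the tree's rendering (architecture `(A′)` of
`HOME/np/NOTE-t21g13-DDS21-B4c-generic-point.md`: the random point is the tuple `y` of
indeterminates, `F′ = Frac F[y]`, the `z`-grading is the `x`-grading after the shift `x ↦ x + y`)
the honest content of these lines is an INVARIANT of brick B4b's exact records
(`DDS2021.ExactTerm`, `DDS21DiDILStep.lean`): every polynomial datum of every term is the generic
shift `H(x, y + x)` of an `x`-WEIGHTED-HOMOGENEOUS two-sorted polynomial `H(x, y)` with
coefficients in `F(ε)` (the universal frame `Literature/RingTheory/MvPolynomial/DirectionalShift`),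
with weights `(w_P, w_Q)` of common excess `w_P − w_Q ∈ {0, 1}` along a stage. This file proves:

* §0 `compMap ι y` (the ring map `H ↦ H^{ι}(x, y + x)`), the predicate `IsPres ι y w p` and its
  algebra; ★ `IsPres.euler`: `E(p) = w·p + δ` with `δ` presented of weight `w + 1` — the chain rule
  `DirShift.euler_shift` (`Σ x_i ∂_i (H(x, α + x)) = (E_x H + D_x H)(x, α + x)`) plus Euler's
  identity `E_x H = w·H`; `isPres_affForm_shift`: the shifted base-changed affine forms (in the
  hypothesis shape of `DDS2021.exists_regular_of_shift`) are presented of weight `0`.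
* §1 `ExactTerm.Companion ι y a b T` (all forms presented of weight `0`, `𝒫.p` of weight `a`,
  `𝒬.p` of weight `b`) and its closure under B4b's `ofForms`, `smul`, `divT`, and — the point —
  ★ `Companion.derT` for BALANCED terms (`a = b`): in `derT` the two Euler contributions
  `a·p·q·den_P²·den_Q²` of `(𝒫.der)·𝒬` and `𝒫·(𝒬.der)` CANCEL (`derT_middle_cancel`), the `ΠΣ`
  logarithmic derivative has none (forms have weight `0`), so only the directional derivative
  `D_x` survives and the new data are presented of weights `(2a + 1, 2a)`; hence `Companion.didil`
  (`didil = derT ∘ divT`, and `divT` of two terms with the same excess is balanced), and the family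
  statements `StageComp e G` ("all terms of the stage have excess `e`"), `stageComp_didilStep`
  (excess becomes `1`: the printed "`z`-homogeneity"), `stageComp_didilIter`, stage `0`.
* §2 `Companion.numPoly`/`Companion.denPoly`: B4b's cleared numerator and denominator polynomials
  are `C κ ·` (presented of weight `a`) and presented of weight `b`.
* §3 At the transcendental point (`K₀ = F(ε)`, `K = F′(ε)`, `ι = ratFuncMap (F → F′)`,
  `y_m ↦ y_m`): ★ `IsPres.exists_model` — a nonzero presented polynomial is `C c · ι(N)` with
  `N ∈ F′[ε][x]`, `ldeg N = w` and `ε`-UNIT INITIAL FORM (`DDS21ShiftInitialForms`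
  `redZero_initialForm_shift_ne_zero` after extracting the `ε`-content, `exists_epsNormalForm`);
  ★★ `exists_stage_model`: for a well-formed stage family `G` with nondegenerate divisor `G i₀`
  and the companion invariant — NO per-form `ε`-regularity hypothesis is needed, the generic
  point makes every presented polynomial regular — the stage ratio `(Σ_i T_i)/T_{i₀}` is `g/E`
  with `E ∈ F′[ε][x]` of `ε`-unit initial form and `g ∈ F′(ε)[x]` vanishing below `ldeg E` —
  exactly the hypotheses of `EpsLim.exists_model_of_mul_intToFrac`/`EpsLim.gradeZero_of_model`
  (`DDS21EpsIntegralGraded`); ★★ `epsLim_gradeZero_stage` (+ `_fractionRing`): therefore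
  `lim_{ε→0}` COMMUTES with `·|_{z=0}` on the (rescaled) stage ratio — Claim 3.8's first displayed
  equality for the objects B4b and `DDS21DiDILExactChain` actually build; ★
  `exists_divisor_limit_ldeg`: the limit `u = tn/td` of the (normalised) divisor has graded
  valuation `ldeg tn − ldeg td` EQUAL to the excess `e` ("`d_{j+1} := d_j − v_{k−j,j} − 1`" with
  `v = [j ≥ 1]` generically).

No named facts (census +0). Two bodied plumbing definitions (`compMap`, `IsPres`) and two Prop
abbreviations of the invariant (`ExactTerm.Companion`, `StageComp`). Inputs BY NAME: brick B4b
`DDS21DiDILStep.lean` v3 (`ExactTerm`, `FormsSat` and its closure, `numPoly/denPoly`,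
`val_eq_numPoly_div_denPoly`, `didilStep/didilIter/ofLiveTerm`), B4a `DDS21GradedFractions.lean`
(`euler`, `ldeg`, `initialForm`), E1/E4.2 `DDS21EpsIntegralFractions/Graded.lean` (`EpsLim`,
`GradeZero`, `EpsLim.exists_model_of_mul_intToFrac`, `EpsLim.gradeZero_of_model`,
`EpsLim.exists_eq_C_mul_of_normalForm`), E4.5a `DDS21ShiftInitialForms.lean`
(`redZero_initialForm_shift_ne_zero`, `epsPoint`), `DDS21BloatedRatioDeborder.lean`
(`exists_epsNormalForm`), `DDS21BorderBaseChange.lean` (`ratFuncMap`), and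
`Literature/RingTheory/MvPolynomial/DirectionalShift.lean` (`shift`, `euler_shift`,
`homogeneousComponent_shift_eq_zero`). Typed vs printed: print keeps
`val_z ≥ 0` and "`U|_{z=0} ∈ F(ε)∖{0}`" as hypotheses maintained by inspection; here they are
consequences of the weight bookkeeping, and the joint integrality "`∈ F(x)[[z,ε]]`" of Claim 3.8 is
replaced by the explicit model `(E, g)` (for a NON-generic shift it can fail — memo F4 of
`HOME/np/MEMO-t21g12-DDS21-B4-DiDIL.md`). Honest framing: bookkeeping for a published 2021 theorem;
`DDS2021_thm_3_2` remains an OPEN named fact; VP ≠ VNP is NOT proved and nothing here bears on it.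

## References

* [DuttaDwivediSaxena2022] P. Dutta, P. Dwivedi, N. Saxena, *Demystifying the border of depth-3
  algebraic circuits*, Proc. 62nd FOCS (2021), IEEE 2022, 92–103; full version
  `paper:galaxy-pdf-7641649743695546420`: the map `Φ` and the random point p0028 L751–760;
  DERIVE p0029 L766–770; induction hypotheses (1)–(3) p0030 L799–805; Divide and Derive, eq. (3.2)
  p0030 L808–812, p0031 L815–817; "Invertibility of `ΠΣ`-circuits" p0031 L836–845; Claim 3.8 with
  proof p0035 L934–941.
-/

noncomputable section

open MvPolynomial
open scoped BigOperators Polynomial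

namespace Literature.Computability.AlgebraicComplexity

namespace DDS2021

open Literature.RingTheory.MvPolynomial

/-! ## §0 Presented polynomials: generic shifts of `x`-weighted-homogeneous two-sorted polynomials -/

section Pres

variable {K₀ K : Type*} [Field K₀] [Field K] (ι : K₀ →+* K) {n : ℕ} (y : Fin n → K)

/-- The companion map `θ = shift_y ∘ map ι : K₀[x ⊔ y] → K[x]`, `H ↦ H^{ι}(x, y + x)` (DDS's
`Φ : x ↦ z·x + α` at the point `y`, with the `z`-degree read as the `x`-grading).
[cite: DuttaDwivediSaxena2022, §3 the map Φ (full version p0028 L751–757)] -/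
def compMap : MvPolynomial (Fin n ⊕ Fin n) K₀ →+* MvPolynomial (Fin n) K :=
  (DirShift.shift K y).toRingHom.comp (map ι)

/-- `p ∈ K[x]` is PRESENTED of `x`-weight `w`: `p = H^{ι}(x, y + x)` for some two-sorted `H` over
`K₀`, weighted-homogeneous of weight `w` for the `x`-grading `DirShift.xWeight`.
[cite: DuttaDwivediSaxena2022, §3 induction hypothesis (3) "v_{i,j} := val_z(T_{i,j}) ≥ 0" (full version p0030 L804–805)] -/
def IsPres (w : ℕ) (p : MvPolynomial (Fin n) K) : Prop :=
  ∃ H : MvPolynomial (Fin n ⊕ Fin n) K₀,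
    IsWeightedHomogeneous (DirShift.xWeight (Fin n)) H w ∧ compMap ι y H = p

variable {ι y}

/-- `compMap` unfolded. [cite: DuttaDwivediSaxena2022, §3 the map Φ (full version p0028 L751–757)] -/
theorem compMap_apply (H : MvPolynomial (Fin n ⊕ Fin n) K₀) :
    compMap ι y H = DirShift.shift K y (map ι H) := rfl

/-- `compMap` on constants. [cite: DuttaDwivediSaxena2022, §3 the map Φ (full version p0028 L751–757)] -/
@[simp] theorem compMap_C (a : K₀) : compMap ι y (C a) = C (ι a) := by
  rw [compMap_apply, map_C, DirShift.shift_C]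

/-- `compMap` on a direction variable `x_l`. [cite: DuttaDwivediSaxena2022, §3 the map Φ (full version p0028 L751–757)] -/
@[simp] theorem compMap_X_inl (l : Fin n) : compMap ι y (X (Sum.inl l)) = X l := by
  rw [compMap_apply, map_X, DirShift.shift_X_inl]

/-- `compMap` on a position variable `y_l`: the shift `y_l + x_l`. [cite: DuttaDwivediSaxena2022, §3 the map Φ (full version p0028 L751–757)] -/
@[simp] theorem compMap_X_inr (l : Fin n) : compMap ι y (X (Sum.inr l)) = C (y l) + X l := by
  rw [compMap_apply, map_X, DirShift.shift_X_inr]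

/-- Mapping coefficients preserves weighted homogeneity (the support can only shrink). (folklore)
[cite: DuttaDwivediSaxena2022, §3 induction hypothesis (3) (full version p0030 L804–805)] -/
theorem isWeightedHomogeneous_map {σ R S M : Type*} [CommSemiring R] [CommSemiring S]
    [AddCommMonoid M] {w : σ → M} (f : R →+* S) {P : MvPolynomial σ R} {d : M}
    (h : IsWeightedHomogeneous w P d) : IsWeightedHomogeneous w (map f P) d := by
  intro m hm
  rw [coeff_map] at hm
  exact h fun h0 => hm (by rw [h0, map_zero])

namespace IsPres

/-- Presented polynomials of weights `a`, `b` multiply to one of weight `a + b`.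
[cite: DuttaDwivediSaxena2022, §3 induction hypothesis (3) (full version p0030 L804–805)] -/
theorem mul {a b : ℕ} {p q : MvPolynomial (Fin n) K} (hp : IsPres ι y a p) (hq : IsPres ι y b q) :
    IsPres ι y (a + b) (p * q) := by
  obtain ⟨H, hH, rfl⟩ := hp
  obtain ⟨G, hG, rfl⟩ := hq
  exact ⟨H * G, hH.mul hG, map_mul _ _ _⟩

/-- Same-weight presented polynomials add. [cite: DuttaDwivediSaxena2022, §3 induction hypothesis (3) (full version p0030 L804–805)] -/
theorem add {a : ℕ} {p q : MvPolynomial (Fin n) K} (hp : IsPres ι y a p) (hq : IsPres ι y a q) :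
    IsPres ι y a (p + q) := by
  obtain ⟨H, hH, rfl⟩ := hp
  obtain ⟨G, hG, rfl⟩ := hq
  exact ⟨H + G, hH.add hG, map_add _ _ _⟩

/-- Negation. [cite: DuttaDwivediSaxena2022, §3 induction hypothesis (3) (full version p0030 L804–805)] -/
theorem neg {a : ℕ} {p : MvPolynomial (Fin n) K} (hp : IsPres ι y a p) : IsPres ι y a (-p) := by
  obtain ⟨H, hH, rfl⟩ := hp
  refine ⟨-H, ?_, map_neg _ _⟩
  exact (mem_weightedHomogeneousSubmodule K₀ _ a _).mp
    (neg_mem ((mem_weightedHomogeneousSubmodule K₀ _ a H).mpr hH))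

/-- Subtraction. [cite: DuttaDwivediSaxena2022, §3 induction hypothesis (3) (full version p0030 L804–805)] -/
theorem sub {a : ℕ} {p q : MvPolynomial (Fin n) K} (hp : IsPres ι y a p) (hq : IsPres ι y a q) :
    IsPres ι y a (p - q) := by
  rw [sub_eq_add_neg]
  exact hp.add hq.neg

/-- Scaling by a natural number. [cite: DuttaDwivediSaxena2022, §3 induction hypothesis (3) (full version p0030 L804–805)] -/
theorem natCast_mul {a : ℕ} {p : MvPolynomial (Fin n) K} (hp : IsPres ι y a p) (c : ℕ) :
    IsPres ι y a ((c : MvPolynomial (Fin n) K) * p) := by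
  obtain ⟨H, hH, rfl⟩ := hp
  refine ⟨(c : MvPolynomial (Fin n ⊕ Fin n) K₀) * H, ?_, by rw [map_mul, map_natCast]⟩
  rw [← nsmul_eq_mul]
  exact (mem_weightedHomogeneousSubmodule K₀ _ a _).mp
    (nsmul_mem ((mem_weightedHomogeneousSubmodule K₀ _ a H).mpr hH) c)

/-- Scaling by a constant from `K₀`. [cite: DuttaDwivediSaxena2022, §3 induction hypothesis (3) (full version p0030 L804–805)] -/
theorem C_mul {a : ℕ} {p : MvPolynomial (Fin n) K} (hp : IsPres ι y a p) (c : K₀) :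
    IsPres ι y a (C (ι c) * p) := by
  obtain ⟨H, hH, rfl⟩ := hp
  have h := (isWeightedHomogeneous_C (DirShift.xWeight (Fin n)) c).mul hH
  rw [zero_add] at h
  exact ⟨C c * H, h, by rw [map_mul, compMap_C]⟩

end IsPres

/-- `1` is presented of weight `0`. [cite: DuttaDwivediSaxena2022, §3 base case "V_{i,0} := P_{i,0} := Q_{i,0} = 1" (full version p0028 L748–750)] -/
theorem isPres_one : IsPres ι y 0 (1 : MvPolynomial (Fin n) K) :=
  ⟨1, isWeightedHomogeneous_one _ _, map_one _⟩

/-- `0` is presented of every weight. [cite: DuttaDwivediSaxena2022, §3 induction hypothesis (3) (full version p0030 L804–805)] -/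
theorem isPres_zero (a : ℕ) : IsPres ι y a (0 : MvPolynomial (Fin n) K) :=
  ⟨0, isWeightedHomogeneous_zero _ _ _, map_zero _⟩

/-- Constants from `K₀` are presented of weight `0`. [cite: DuttaDwivediSaxena2022, §3 induction hypothesis (3) (full version p0030 L804–805)] -/
theorem isPres_C (c : K₀) : IsPres ι y 0 (C (ι c) : MvPolynomial (Fin n) K) :=
  ⟨C c, isWeightedHomogeneous_C _ c, compMap_C c⟩

/-- Finite products of weight-`0` presented polynomials. [cite: DuttaDwivediSaxena2022, §3 "Invertibility of ΠΣ-circuits" (full version p0031 L836–845)] -/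
theorem isPres_list_prod {L : List (MvPolynomial (Fin n) K)} (hL : ∀ p ∈ L, IsPres ι y 0 p) :
    IsPres ι y 0 L.prod := by
  induction L with
  | nil => exact isPres_one
  | cons p L ih =>
    rw [List.prod_cons]
    have h := (hL p (by simp)).mul (ih fun q hq => hL q (by simp [hq]))
    rwa [zero_add] at h

/-- The product of a list of affine forms all presented of weight `0` is presented of weight `0`.
[cite: DuttaDwivediSaxena2022, §3 "Invertibility of ΠΣ-circuits" (full version p0031 L836–845)] -/
theorem isPres_formProd {L : List (Option (Fin n) → K)} (hL : ∀ a ∈ L, IsPres ι y 0 (affForm a)) :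
    IsPres ι y 0 (formProd L) := by
  rw [formProd]
  refine isPres_list_prod fun p hp => ?_
  obtain ⟨a, ha, rfl⟩ := List.mem_map.1 hp
  exact hL a ha

/-- ★ **The Euler operator on a presented polynomial**: `E(p) = w·p + δ` with `δ` presented of
weight `w + 1` — the chain rule `Σ_i x_i ∂_i (H(x, y + x)) = (E_x H + D_x H)(x, y + x)`
(`DirShift.euler_shift`) and Euler's identity `E_x H = w·H`; `δ = (D_x H)^{ι}(x, y + x)`.
[cite: DuttaDwivediSaxena2022, §3 DERIVE "∂_z Φ(f)" and eq. (3.2) (full version p0029 L766–770, p0030 L808–812)] -/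
theorem IsPres.euler {w : ℕ} {p : MvPolynomial (Fin n) K} (hp : IsPres ι y w p) :
    ∃ δ, IsPres ι y (w + 1) δ ∧ euler (Fin n) K p = (w : MvPolynomial (Fin n) K) * p + δ := by
  obtain ⟨H, hH, rfl⟩ := hp
  have hH' : IsWeightedHomogeneous (DirShift.xWeight (Fin n)) (map ι H) w :=
    isWeightedHomogeneous_map ι hH
  refine ⟨compMap ι y (DirShift.dirDeriv (Fin n) K₀ H), ⟨_, hH.dirShift_dirDeriv, rfl⟩, ?_⟩
  rw [compMap_apply, compMap_apply, euler_eq_sum_X_mul_pderiv,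
    DirShift.euler_shift_of_isWeightedHomogeneous y hH', DirShift.map_dirDeriv, nsmul_eq_mul]

/-- **Shifted base-changed affine forms are presented of weight `0`.** In the hypothesis shape of
`DDS2021.exists_regular_of_shift` (`a′₀ = ι a₀ + Σ_m ι a_m · y_m`, `a′_m = ι a_m`):
`affForm a′ = H(x, y + x)` for `H = a₀ + Σ_m a_m · y_m ∈ K₀[x ⊔ y]` (weight `0`).
[cite: DuttaDwivediSaxena2022, §3 the map Φ (full version p0028 L751–754)] -/
theorem isPres_affForm_shift {a : Option (Fin n) → K₀} {a' : Option (Fin n) → K}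
    (hnone : a' none = ι (a none) + ∑ m, ι (a (some m)) * y m)
    (hsome : ∀ m, a' (some m) = ι (a (some m))) : IsPres ι y 0 (affForm a') := by
  refine ⟨C (a none) + ∑ m, C (a (some m)) * X (Sum.inr m), ?_, ?_⟩
  · refine (isWeightedHomogeneous_C _ _).add (IsWeightedHomogeneous.sum _ _ _ fun m _ => ?_)
    have h := (isWeightedHomogeneous_C (DirShift.xWeight (Fin n)) (a (some m))).mul
      (DirShift.isWeightedHomogeneous_X_inr (R := K₀) m)
    rwa [add_zero] at h
  · rw [affForm, map_add, compMap_C, map_sum, hnone, C_add, add_assoc]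
    congr 1
    rw [map_sum C, ← Finset.sum_add_distrib]
    refine Finset.sum_congr rfl fun m _ => ?_
    rw [map_mul, compMap_C, compMap_X_inr, hsome, C_mul, mul_add]

end Pres

/-! ## §1 The companion invariant on B4b's exact records and its closure under the DiDIL step -/

section Companion

variable {K₀ K : Type*} [Field K₀] [Field K] {ι : K₀ →+* K} {n : ℕ} {y : Fin n → K}

/-- Transport of a presentation along an equality of weights. [cite: DuttaDwivediSaxena2022, §3 induction hypothesis (3) (full version p0030 L804–805)] -/
theorem IsPres.of_eq_weight {a b : ℕ} {p : MvPolynomial (Fin n) K} (h : IsPres ι y a p) (e : a = b) :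
    IsPres ι y b p := e ▸ h

namespace FracPair

/-- The denominator of a fraction all of whose forms are presented is presented of weight `0`.
[cite: DuttaDwivediSaxena2022, §3 "Invertibility of ΠΣ-circuits" (full version p0031 L836–845)] -/
theorem isPres_den {P : FracPair K n} (hL : ∀ a ∈ P.L, IsPres ι y 0 (affForm a)) :
    IsPres ι y 0 P.den :=
  isPres_formProd hL

/-- `den (P.sub Q) = den P · den Q`. [cite: DuttaDwivediSaxena2022, §3 proof of Thm. 3.2, eq. (3.2) (full version p0030 L808–812)] -/
theorem den_sub (P Q : FracPair K n) : (P.sub Q).den = P.den * Q.den := by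
  rw [FracPair.sub, den_add, den_neg]

/-- ★ **The Euler derivative of a presented fraction**: if `𝒫 = p/Π` has `p` presented of weight
`w` and all forms presented, then the numerator of `𝒫.der E` is `w·(p·Π) + δ` with `δ` presented of
weight `w + 1` (the Euler part of `E p · Π − p · E Π` is `w·p·Π`; `E Π` has none).
[cite: DuttaDwivediSaxena2022, §3 proof of Thm. 3.2, Divide and Derive, eq. (3.2) (full version p0030 L808–812, p0031 L815–817)] -/
theorem der_p_presented {w : ℕ} {P : FracPair K n} (hp : IsPres ι y w P.p)
    (hL : ∀ a ∈ P.L, IsPres ι y 0 (affForm a)) :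
    ∃ δ, IsPres ι y (w + 1) δ ∧
      (P.der (euler (Fin n) K)).p = (w : MvPolynomial (Fin n) K) * (P.p * P.den) + δ := by
  obtain ⟨δp, hδp, hEp⟩ := hp.euler
  obtain ⟨δd, hδd, hEd⟩ := (isPres_den hL).euler
  refine ⟨δp * P.den - P.p * δd, ?_, ?_⟩
  · exact ((hδp.mul (isPres_den hL)).of_eq_weight (by omega)).sub ((hp.mul hδd).of_eq_weight (by omega))
  · rw [der_p, hEp, hEd, Nat.cast_zero, zero_mul, zero_add]
    ring

end FracPair

namespace PiRatio

/-- The numerator of the logarithmic derivative `A.dlog E` of a `ΠΣ`-ratio with presented forms is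
presented of weight `1` (no Euler part: forms have `x`-weight `0`), its denominator of weight `0`.
[cite: DuttaDwivediSaxena2022, §3 proof of Thm. 3.2, eq. (3.3) "dlog distributes the product additively" (full version p0031 L836–838, p0032 L854–862)] -/
theorem dlog_presented {A : PiRatio K n} (hnum : ∀ a ∈ A.num, IsPres ι y 0 (affForm a))
    (hden : ∀ a ∈ A.den, IsPres ι y 0 (affForm a)) :
    IsPres ι y 1 (A.dlog (euler (Fin n) K)).p ∧ IsPres ι y 0 (A.dlog (euler (Fin n) K)).den := by
  obtain ⟨δn, hδn, hEn⟩ := (isPres_formProd hnum).euler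
  obtain ⟨δd, hδd, hEd⟩ := (isPres_formProd hden).euler
  rw [Nat.cast_zero, zero_mul, zero_add] at hEn hEd
  constructor
  · have e : (A.dlog (euler (Fin n) K)).p =
        euler (Fin n) K (formProd A.num) * formProd A.den -
          euler (Fin n) K (formProd A.den) * formProd A.num := by
      rw [PiRatio.dlog, FracPair.sub_p]
      rfl
    rw [e, hEn, hEd]
    exact ((hδn.mul (isPres_formProd hden)).of_eq_weight (by omega)).sub
      ((hδd.mul (isPres_formProd hnum)).of_eq_weight (by omega))
  · rw [FracPair.den, PiRatio.dlog_L, formProd_append]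
    have h := (isPres_formProd hnum).mul (isPres_formProd hden)
    exact h

end PiRatio

/-- The polynomial identity behind `derT` on a BALANCED term: the two Euler contributions
`w·p·q·Π_P²·Π_Q²` of `(𝒫.der)·𝒬` and `𝒫·(𝒬.der)` cancel. (folklore)
[cite: DuttaDwivediSaxena2022, §3 proof of Thm. 3.2, Divide and Derive, eq. (3.2) (full version p0030 L808–812)] -/
theorem derT_middle_cancel {R : Type*} [CommRing R] {p q dP dQ p' q' δP δQ w : R}
    (hp' : p' = w * (p * dP) + δP) (hq' : q' = w * (q * dQ) + δQ) :
    p' * q * (dP * (dQ * dQ)) - p * q' * (dP * dP * dQ) =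
      δP * q * (dP * (dQ * dQ)) - p * δQ * (dP * dP * dQ) := by
  subst hp' hq'
  ring

namespace ExactTerm

variable (ι y) in
/-- **The companion invariant** of an exact term `T = A·𝒫/𝒬` with weights `(a, b)`: every affine
form of `T` is the generic shift of a form over `K₀` (presented of weight `0`), the numerator of
`𝒫` is presented of `x`-weight `a` and the numerator of `𝒬` of `x`-weight `b` (so
`val_z(T) = a − b` in the printed bookkeeping, and "`U|_{z=0}, V|_{z=0} ∈ F(ε)∖{0}`").
[cite: DuttaDwivediSaxena2022, §3 induction hypotheses (2)–(3) (full version p0030 L801–805)] -/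
def Companion (a b : ℕ) (T : ExactTerm K n) : Prop :=
  T.FormsSat (fun α => IsPres ι y 0 (affForm α)) ∧ IsPres ι y a T.P.p ∧ IsPres ι y b T.Q.p

/-- The forms of a companion term. [cite: DuttaDwivediSaxena2022, §3 induction hypotheses (2)–(3) (full version p0030 L801–805)] -/
theorem Companion.formsSat {a b : ℕ} {T : ExactTerm K n} (h : Companion ι y a b T) :
    T.FormsSat (fun α => IsPres ι y 0 (affForm α)) := h.1

/-- The `𝒫`-numerator of a companion term. [cite: DuttaDwivediSaxena2022, §3 induction hypotheses (2)–(3) (full version p0030 L801–805)] -/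
theorem Companion.pres_P {a b : ℕ} {T : ExactTerm K n} (h : Companion ι y a b T) :
    IsPres ι y a T.P.p := h.2.1

/-- The `𝒬`-numerator of a companion term. [cite: DuttaDwivediSaxena2022, §3 induction hypotheses (2)–(3) (full version p0030 L801–805)] -/
theorem Companion.pres_Q {a b : ℕ} {T : ExactTerm K n} (h : Companion ι y a b T) :
    IsPres ι y b T.Q.p := h.2.2

/-- **Stage `0`**: a term `κ · ∏ L` all of whose forms are presented is a companion term of weights
`(0, 0)` ("`P_{i,0} := Q_{i,0} = 1`").
[cite: DuttaDwivediSaxena2022, §3 proof of Thm. 3.2, base case (full version p0028 L748–750)] -/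
theorem companion_ofForms (κ : K) (hκ : κ ≠ 0) (L : List (Option (Fin n) → K))
    (hL : ∀ a ∈ L, a none ≠ 0) (hP : ∀ a ∈ L, IsPres ι y 0 (affForm a)) :
    Companion ι y 0 0 (ofForms κ hκ L hL) :=
  ⟨formsSat_ofForms κ hκ L hL hP, isPres_one, isPres_one⟩

/-- Scalars do not touch the invariant. [cite: DuttaDwivediSaxena2022, §3 "Invertibility of ΠΣ-circuits", the scalar ε^{-a} (full version p0031 L838–845)] -/
theorem Companion.smul {a b : ℕ} {T : ExactTerm K n} (h : Companion ι y a b T) (c : K) (hc : c ≠ 0) :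
    Companion ι y a b (T.smul c hc) :=
  ⟨FormsSat.smul c hc h.formsSat, h.pres_P, h.pres_Q⟩

/-- **Closure under `divT`**: weights `(a, b), (a′, b′) ↦ (a + b′, b + a′)`
("`T_{i,j}/T̃ = (U_{i,j+1}/V_{i,j+1}) · (P_{i,j} Q_{k−j,j})/(Q_{i,j} P_{k−j,j})`").
[cite: DuttaDwivediSaxena2022, §3 "Invertibility of ΠΣ-circuits" (full version p0031 L838–845)] -/
theorem Companion.divT {a b a' b' : ℕ} {T S : ExactTerm K n} (hT : Companion ι y a b T)
    (hS : Companion ι y a' b' S) : Companion ι y (a + b') (b + a') (T.divT S) :=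
  ⟨hT.formsSat.divT hS.formsSat, hT.pres_P.mul hS.pres_Q, hT.pres_Q.mul hS.pres_P⟩

/-- ★ **Closure under `derT` for BALANCED terms** (`w_𝒫 = w_𝒬 = c`): the new weights are
`(2c + 1, 2c)`. The Euler parts cancel (`derT_middle_cancel`); the `dlog` of the `ΠΣ`-ratio and
the directional derivatives raise the `x`-weight of the numerator by exactly one ("DERIVE").
[cite: DuttaDwivediSaxena2022, §3 proof of Thm. 3.2, Divide and Derive, eq. (3.2), and `T_{i,j+1} := (T_{i,j}/T̃)·dlog(T_{i,j}/T̃)` (full version p0030 L808–812, p0031 L815–817)] -/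
theorem Companion.derT {c : ℕ} {T : ExactTerm K n} (h : Companion ι y c c T) :
    Companion ι y (2 * c + 1) (2 * c) (T.derT (euler (Fin n) K)) := by
  obtain ⟨⟨hAn, hAd, hPL, hQL⟩, hP, hQ⟩ := h
  have hdP : IsPres ι y 0 T.P.den := FracPair.isPres_den hPL
  have hdQ : IsPres ι y 0 T.Q.den := FracPair.isPres_den hQL
  obtain ⟨hlp, hld⟩ := PiRatio.dlog_presented (ι := ι) (y := y) hAn hAd
  obtain ⟨δP, hδP, hP'⟩ := FracPair.der_p_presented hP hPL
  obtain ⟨δQ, hδQ, hQ'⟩ := FracPair.der_p_presented hQ hQL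
  refine ⟨FormsSat.derT (euler (Fin n) K) ⟨hAn, hAd, hPL, hQL⟩, ?_, ?_⟩
  · -- the new `𝒫`-numerator: `X.p · Y.den + Y.p · X.den`
    have eP : (T.derT (euler (Fin n) K)).P.p =
        (T.A.dlog (euler (Fin n) K)).p * (T.P.p * T.Q.p) *
            ((T.P.den * T.P.den * T.Q.den) * (T.P.den * (T.Q.den * T.Q.den))) +
          ((T.P.der (euler (Fin n) K)).p * T.Q.p * (T.P.den * (T.Q.den * T.Q.den)) -
              T.P.p * (T.Q.der (euler (Fin n) K)).p * (T.P.den * T.P.den * T.Q.den)) *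
            ((T.A.dlog (euler (Fin n) K)).den * (T.P.den * T.Q.den)) := by
      simp only [ExactTerm.derT, FracPair.add_p, FracPair.mul_p, FracPair.sub_p, FracPair.den_mul,
        FracPair.den_sub, FracPair.den_der]
    rw [eP, derT_middle_cancel hP' hQ']
    refine IsPres.add ?_ ?_
    · exact (((hlp.mul (hP.mul hQ)).mul (((hdP.mul hdP).mul hdQ).mul (hdP.mul (hdQ.mul hdQ)))).of_eq_weight
        (by omega))
    · have hY : IsPres ι y (2 * c + 1)
          ((δP * T.Q.p * (T.P.den * (T.Q.den * T.Q.den)) -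
            T.P.p * δQ * (T.P.den * T.P.den * T.Q.den))) :=
        (((hδP.mul hQ).mul (hdP.mul (hdQ.mul hdQ))).of_eq_weight (by omega)).sub
          (((hP.mul hδQ).mul ((hdP.mul hdP).mul hdQ)).of_eq_weight (by omega))
      exact (hY.mul (hld.mul (hdP.mul hdQ))).of_eq_weight (by omega)
  · -- the new `𝒬`-numerator `q · q`
    have eQ : (T.derT (euler (Fin n) K)).Q.p = T.Q.p * T.Q.p := by
      simp only [ExactTerm.derT, FracPair.mul_p]
    rw [eQ]
    exact (hQ.mul hQ).of_eq_weight (by omega)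

/-- ★ **Closure under one DiDIL operation** `didil E T S = (T.divT S).derT E` for terms of the SAME
EXCESS (`a + b′ = b + a′`, i.e. `a − b = a′ − b′`: all terms of a stage have the same `val_z`
bookkeeping): the new weights are `(2(a + b′) + 1, 2(a + b′))`, of excess `1`.
[cite: DuttaDwivediSaxena2022, §3 proof of Thm. 3.2, `T_{i,j+1} := (T_{i,j}/T̃_{k−j,j})·dlog(T_{i,j}/T̃_{k−j,j})` (full version p0031 L815–817)] -/
theorem Companion.didil {a b a' b' : ℕ} {T S : ExactTerm K n} (hT : Companion ι y a b T)
    (hS : Companion ι y a' b' S) (hbal : a + b' = b + a') :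
    Companion ι y (2 * (a + b') + 1) (2 * (a + b')) (didil (euler (Fin n) K) T S) := by
  have h := hT.divT hS
  rw [← hbal] at h
  exact h.derT

end ExactTerm

variable (ι y) in
/-- **The stage invariant**: all terms of the family are companion terms of a COMMON EXCESS `e`
(weights `(c_i + e, c_i)`): `e = 0` at stage `0`, `e = 1` after every round.
[cite: DuttaDwivediSaxena2022, §3 induction hypotheses (2)–(3) (full version p0030 L801–805)] -/
def StageComp (e : ℕ) {m : ℕ} (G : Fin m → ExactTerm K n) : Prop :=
  ∀ i, ∃ c, ExactTerm.Companion ι y (c + e) c (G i)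

/-- ★ **One DiDIL step keeps the stage invariant**, with excess `1` afterwards.
[cite: DuttaDwivediSaxena2022, §3 proof of Thm. 3.2, Divide and Derive (full version p0030 L808–812, p0031 L815–817)] -/
theorem stageComp_didilStep {e m : ℕ} {G : Fin (m + 1) → ExactTerm K n} (hG : StageComp ι y e G)
    (i₀ : Fin (m + 1)) : StageComp ι y 1 (didilStep (euler (Fin n) K) G i₀) := by
  intro i
  obtain ⟨c, hc⟩ := hG (i₀.succAbove i)
  obtain ⟨c₀, hc₀⟩ := hG i₀
  refine ⟨2 * (c + e + c₀), ?_⟩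
  have h := hc.didil hc₀ (by omega)
  exact h

/-- **The DiDIL iteration keeps the stage invariant** (some excess at every stage).
[cite: DuttaDwivediSaxena2022, §3 proof of Thm. 3.2, the induction over j (full version p0030 L797–812)] -/
theorem stageComp_didilIter (c : Choice K n) (m : ℕ) :
    ∀ (j : ℕ) {e : ℕ} (G : Fin (m + j) → ExactTerm K n), StageComp ι y e G →
      ∃ e', StageComp ι y e' (didilIter (euler (Fin n) K) c m j G)
  | 0, e, _, hG => ⟨e, hG⟩
  | j + 1, _, G, hG => by
    rw [didilIter_succ]
    exact stageComp_didilIter c m j _ (stageComp_didilStep hG _)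

/-- After at least one round the excess is `1`. [cite: DuttaDwivediSaxena2022, §3 proof of Thm. 3.2, the induction over j (full version p0030 L797–812)] -/
theorem stageComp_didilIter_succ (c : Choice K n) (m : ℕ) :
    ∀ (j : ℕ) {e : ℕ} (G : Fin (m + (j + 1)) → ExactTerm K n), StageComp ι y e G →
      StageComp ι y 1 (didilIter (euler (Fin n) K) c m (j + 1) G)
  | 0, _, G, hG => by
    rw [didilIter_succ, didilIter_zero]
    exact stageComp_didilStep hG _
  | j + 1, _, G, hG => by
    rw [didilIter_succ]
    exact stageComp_didilIter_succ c m j _ (stageComp_didilStep hG _)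

/-- **Stage `0` from live product terms**: a family of `ofLiveTerm`s over presented forms has the
stage invariant with excess `0`. [cite: DuttaDwivediSaxena2022, §3 proof of Thm. 3.2, base case (full version p0028 L748–754)] -/
theorem stageComp_zero_of_ofLiveTerm {k d m : ℕ} {α : Fin k → Fin d → Option (Fin n) → K}
    {G : Fin m → ExactTerm K n}
    (hG : ∀ i, ∃ (i' : Fin k) (h : LiveTerm (α i')), G i = ofLiveTerm (α i') h)
    (hα : ∀ i' j, IsPres ι y 0 (affForm (α i' j))) : StageComp ι y 0 G := by
  intro i
  obtain ⟨i', h, hGi⟩ := hG i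
  refine ⟨0, ?_⟩
  rw [hGi, ofLiveTerm]
  exact ExactTerm.companion_ofForms _ _ _ _ fun a ha => by
    obtain ⟨j, rfl⟩ := List.mem_ofFn.1 ha
    exact hα i' j

/-- **The stage invariant along a sigma-typed DiDIL run** (the round shape of
`DDS21TranscriptResidues.exists_didil_run`: `Fam j = ⟨m′+1, G′⟩`, `Fam (j+1) = ⟨m′, didilStep G′ i₀⟩`):
from excess `0` at stage `0`, every stage `j ≤ r` has excess `min j 1`.
[cite: DuttaDwivediSaxena2022, §3 proof of Thm. 3.2, induction hypotheses (2)–(3) carried over j (full version p0030 L799–805)] -/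
theorem stageComp_run {r : ℕ} {Fam : ℕ → (Σ m' : ℕ, Fin m' → ExactTerm K n)}
    (hstep : ∀ j, j < r → ∃ (m' : ℕ) (G' : Fin (m' + 1) → ExactTerm K n) (i₀ : Fin (m' + 1)),
      Fam j = ⟨m' + 1, G'⟩ ∧ Fam (j + 1) = ⟨m', didilStep (euler (Fin n) K) G' i₀⟩)
    (h0 : StageComp ι y 0 (Fam 0).2) :
    ∀ j, j ≤ r → StageComp ι y (min j 1) (Fam j).2 := by
  intro j
  induction j with
  | zero => exact fun _ => h0
  | succ j ih =>
    intro hj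
    obtain ⟨m', G', i₀, hFj, hFj1⟩ := hstep j (Nat.lt_of_succ_le hj)
    have hG' : StageComp ι y (min j 1) G' := by
      have h := ih (Nat.le_of_succ_le hj)
      rw [hFj] at h
      exact h
    rw [hFj1, show min (j + 1) 1 = 1 from Nat.min_eq_right (Nat.succ_le_succ (Nat.zero_le j))]
    exact stageComp_didilStep hG' i₀

end Companion

/-! ## §2 The cleared numerator and denominator polynomials of a companion term -/

section NumDen

variable {K₀ K : Type*} [Field K₀] [Field K] {ι : K₀ →+* K} {n : ℕ} {y : Fin n → K}

namespace ExactTerm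

/-- `numPoly T = C κ · (∏num · p · Π_𝒬)` with the bracket presented of weight `a`.
[cite: DuttaDwivediSaxena2022, §3 proof of Thm. 3.2, the terms `(U/V)·(P/Q)` (full version p0030 L801–805)] -/
theorem Companion.numPoly {a b : ℕ} {T : ExactTerm K n} (h : Companion ι y a b T) :
    ∃ N, IsPres ι y a N ∧ T.numPoly = C T.A.κ * N := by
  obtain ⟨⟨hAn, -, -, hQL⟩, hP, -⟩ := h
  refine ⟨formProd T.A.num * T.P.p * T.Q.den, ?_, by rw [ExactTerm.numPoly]; ring⟩
  exact (((isPres_formProd hAn).mul hP).mul (FracPair.isPres_den hQL)).of_eq_weight (by omega)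

/-- `denPoly T = ∏den · q · Π_𝒫` is presented of weight `b`.
[cite: DuttaDwivediSaxena2022, §3 proof of Thm. 3.2, the terms `(U/V)·(P/Q)` (full version p0030 L801–805)] -/
theorem Companion.denPoly {a b : ℕ} {T : ExactTerm K n} (h : Companion ι y a b T) :
    IsPres ι y b T.denPoly := by
  obtain ⟨⟨-, hAd, hPL, -⟩, -, hQ⟩ := h
  rw [ExactTerm.denPoly]
  exact (((isPres_formProd hAd).mul hQ).mul (FracPair.isPres_den hPL)).of_eq_weight (by omega)

end ExactTerm

end NumDen

/-! ## §3 At the transcendental point: models with `ε`-unit initial forms and the stage model -/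

section Vanish

variable {K₀ K : Type*} [Field K₀] [Field K] {ι : K₀ →+* K} {n : ℕ} {y : Fin n → K}

/-- **A presented polynomial of weight `w` vanishes below degree `w`** (`val_z ≥ w` — for any
point `y`; at the transcendental point `ldeg = w` exactly, `IsPres.exists_model`).
[cite: DuttaDwivediSaxena2022, §3 induction hypothesis (3) "v_{i,j} := val_z(T_{i,j}) ≥ 0" (full version p0030 L804–805)] -/
theorem IsPres.vanishing {w : ℕ} {p : MvPolynomial (Fin n) K} (hp : IsPres ι y w p) :
    ∀ d : Fin n →₀ ℕ, d.degree < w → coeff d p = 0 := by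
  intro d hd
  obtain ⟨H, hH, rfl⟩ := hp
  have h0 := congrArg (coeff d)
    (DirShift.homogeneousComponent_shift_eq_zero y (isWeightedHomogeneous_map ι hH) hd)
  rwa [coeff_homogeneousComponent, if_pos rfl, coeff_zero] at h0

/-- Vanishing below a degree for finite products: the thresholds add. (folklore)
[cite: DuttaDwivediSaxena2022, §3 induction hypothesis (3) (full version p0030 L804–805)] -/
theorem vanishing_prod {R : Type*} [CommSemiring R] {σ ι' : Type*} (s : Finset ι')
    (f : ι' → MvPolynomial σ R) (a : ι' → ℕ)
    (h : ∀ i ∈ s, ∀ d : σ →₀ ℕ, d.degree < a i → coeff d (f i) = 0) :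
    ∀ d : σ →₀ ℕ, d.degree < ∑ i ∈ s, a i → coeff d (∏ i ∈ s, f i) = 0 := by
  classical
  induction s using Finset.induction_on with
  | empty => intro d hd; simp at hd
  | insert i s hi ih =>
    intro d hd
    rw [Finset.prod_insert hi]
    rw [Finset.sum_insert hi] at hd
    exact coeff_mul_eq_zero_of_vanishing (h i (Finset.mem_insert_self i s))
      (ih fun j hj => h j (Finset.mem_insert_of_mem hj)) d hd

/-- Vanishing below a degree for finite sums. (folklore)
[cite: DuttaDwivediSaxena2022, §3 induction hypothesis (3) (full version p0030 L804–805)] -/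
theorem vanishing_sum {R : Type*} [CommSemiring R] {σ ι' : Type*} (s : Finset ι')
    (f : ι' → MvPolynomial σ R) {N : ℕ}
    (h : ∀ i ∈ s, ∀ d : σ →₀ ℕ, d.degree < N → coeff d (f i) = 0) :
    ∀ d : σ →₀ ℕ, d.degree < N → coeff d (∑ i ∈ s, f i) = 0 := by
  intro d hd
  rw [coeff_sum]
  exact Finset.sum_eq_zero fun i hi => h i hi d hd

/-- Vanishing below a degree is insensitive to scalars. (folklore)
[cite: DuttaDwivediSaxena2022, §3 induction hypothesis (3) (full version p0030 L804–805)] -/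
theorem vanishing_C_mul {R : Type*} [CommSemiring R] {σ : Type*} (c : R) {p : MvPolynomial σ R}
    {N : ℕ} (h : ∀ d : σ →₀ ℕ, d.degree < N → coeff d p = 0) :
    ∀ d : σ →₀ ℕ, d.degree < N → coeff d (C c * p) = 0 := by
  intro d hd
  rw [coeff_C_mul, h d hd, mul_zero]

/-- `ldeg` of a finite product over a domain. (folklore)
[cite: DuttaDwivediSaxena2022, §3 induction hypothesis (3) (full version p0030 L804–805)] -/
theorem ldeg_prod {R : Type*} [CommSemiring R] [NoZeroDivisors R] [Nontrivial R] {σ ι' : Type*}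
    (s : Finset ι') (f : ι' → MvPolynomial σ R) (h : ∀ i ∈ s, f i ≠ 0) :
    ldeg (∏ i ∈ s, f i) = ∑ i ∈ s, ldeg (f i) := by
  classical
  induction s using Finset.induction_on with
  | empty => rw [Finset.prod_empty, Finset.sum_empty, ← C_1, ldeg_C]
  | insert i s hi ih =>
    rw [Finset.prod_insert hi, Finset.sum_insert hi,
      ldeg_mul (h i (Finset.mem_insert_self i s))
        (Finset.prod_ne_zero_iff.mpr fun j hj => h j (Finset.mem_insert_of_mem hj)),
      ih fun j hj => h j (Finset.mem_insert_of_mem hj)]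

end Vanish

section Transcendental

variable {F : Type*} [Field F] {n : ℕ} {F' : Type*} [Field F'] [Algebra F F']
  [Algebra (MvPolynomial (Fin n) F) F'] [IsScalarTower F (MvPolynomial (Fin n) F) F']

/-- A model with a unit constant coefficient at `ε = 0` has `ldeg = 0` and `ε`-unit initial form
(the regular `ΠΣ` models of `exists_regularModel_formProd`). (folklore)
[cite: DuttaDwivediSaxena2022, §3 induction hypothesis (3) "U_{i,j}|_{z=0} ∈ F(ε)∖{0}" (full version p0030 L804–805)] -/
theorem ldeg_eq_zero_of_coeff_zero_redZero {X : MvPolynomial (Fin n) F'[X]}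
    (h : coeff 0 (redZero F' (Fin n) X) ≠ 0) :
    ldeg X = 0 ∧ redZero F' (Fin n) (initialForm X) ≠ 0 := by
  have h0 : coeff 0 X ≠ 0 := by
    intro h0
    apply h
    rw [redZero_apply, coeff_map, h0, map_zero]
  have hX : X ≠ 0 := fun hX => h0 (by rw [hX, coeff_zero])
  have hl : ldeg X = 0 := (ldeg_eq_zero_iff hX).mpr h0
  refine ⟨hl, ?_⟩
  rw [initialForm, hl, homogeneousComponent_zero, redZero_apply, map_C]
  rw [redZero_apply, coeff_map] at h
  exact C_eq_zero.not.mpr h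

/-- Weighted homogeneity is inherited by the `ε`-content-free part `G` of `H = C c · ι(G)`.
(folklore) [cite: DuttaDwivediSaxena2022, §2 "Valuation" (full version p0015 L407–410)] -/
theorem isWeightedHomogeneous_of_C_mul_map {σ M : Type*} [AddCommMonoid M] {w : σ → M} {d : M}
    {c : RatFunc F} (hc : c ≠ 0) {G : MvPolynomial σ F[X]} {H : MvPolynomial σ (RatFunc F)}
    (hH : H = C c * map (algebraMap F[X] (RatFunc F)) G) (h : IsWeightedHomogeneous w H d) :
    IsWeightedHomogeneous w G d := by
  intro m hm
  apply h
  rw [hH, coeff_C_mul, coeff_map]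
  exact mul_ne_zero hc (fun h0 => hm (RatFunc.algebraMap_injective F (by rw [h0, map_zero])))

omit [Algebra F F'] [IsScalarTower F (MvPolynomial (Fin n) F) F'] in
/-- The point `y` read in `F′(ε)` is the `F′[ε]`-valued point `epsPoint` read in `F′(ε)`. (folklore)
[cite: DuttaDwivediSaxena2022, §3 the map Φ (full version p0028 L751–757)] -/
theorem algebraMap_comp_epsPoint :
    (algebraMap F'[X] (RatFunc F') : F'[X] → RatFunc F') ∘ epsPoint (Fin n) F F' =
      fun m => algebraMap F' (RatFunc F') (algebraMap (MvPolynomial (Fin n) F) F' (X m)) := by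
  funext m
  simp only [Function.comp_apply, epsPoint]
  rw [RatFunc.algebraMap_C, RatFunc.algebraMap_eq_C]

/-- ★ **Presented polynomials have models with `ε`-UNIT INITIAL FORMS at the transcendental
point.** If `p ≠ 0` is presented of weight `w` (for `ι = ratFuncMap (F → F′)` and the point
`y_m ↦ y_m` of a field `F′ ⊇ F[y]`), then `p = C c · ι′(N)` with `c ≠ 0`, `N ∈ F′[ε][x]`,
`ldeg N = w` and `red_ε(in_x N) ≠ 0`: extract the `ε`-content of the two-sorted presentation
(`exists_epsNormalForm`), shift (`DDS21ShiftInitialForms.redZero_initialForm_shift_ne_zero`).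
This is "`val_z(T) = w`" together with "`U|_{z=0} ∈ F(ε)∖{0}`" for the generic `α`.
[cite: DuttaDwivediSaxena2022, §3 induction hypothesis (3) (full version p0030 L804–805); Claim 3.8 proof "valuation with respect to z and ε is non-negative" (p0035 L935–936)] -/
theorem IsPres.exists_model (hinj : Function.Injective (algebraMap (MvPolynomial (Fin n) F) F'))
    {w : ℕ} {p : MvPolynomial (Fin n) (RatFunc F')}
    (hp : IsPres (ratFuncMap (algebraMap F F'))
      (fun m => algebraMap F' (RatFunc F') (algebraMap (MvPolynomial (Fin n) F) F' (X m))) w p)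
    (hp0 : p ≠ 0) :
    ∃ (c : RatFunc F') (N : MvPolynomial (Fin n) F'[X]), c ≠ 0 ∧
      p = C c * map (algebraMap F'[X] (RatFunc F')) N ∧ ldeg N = w ∧
      redZero F' (Fin n) (initialForm N) ≠ 0 := by
  obtain ⟨H, hH, rfl⟩ := hp
  have hH0 : H ≠ 0 := fun h => hp0 (by rw [h, map_zero])
  obtain ⟨c, G, hc, hHG, hG0⟩ := exists_epsNormalForm H hH0
  have hGw : IsWeightedHomogeneous (DirShift.xWeight (Fin n)) G w :=
    isWeightedHomogeneous_of_C_mul_map hc hHG hH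
  have hprim : redZero F (Fin n ⊕ Fin n) G ≠ 0 := by rwa [redZero_apply]
  obtain ⟨hl, -, hred⟩ := redZero_initialForm_shift_ne_zero hinj hGw hprim
  refine ⟨ratFuncMap (algebraMap F F') c,
    DirShift.shift F'[X] (epsPoint (Fin n) F F') (map (Polynomial.mapRingHom (algebraMap F F')) G),
    (map_ne_zero _).mpr hc, ?_, hl, hred⟩
  rw [DirShift.map_shift, algebraMap_comp_epsPoint, map_map, ← ratFuncMap_comp_algebraMap,
    ← map_map, hHG, map_mul, compMap_C, compMap_apply]

/-- ★★ **THE STAGE MODEL (Claim 3.8's "`g_j/T̃ ∈ F(x)[[z, ε]]`", generic point).** For a stage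
family `G` of well-formed exact terms over `F′(ε)` carrying the companion invariant (common excess
`e`) and a nondegenerate divisor `G i₀`, the stage ratio `(Σ_i T_i)/T_{i₀}` equals `g/E` with
`E ∈ F′[ε][x]` of `ε`-UNIT INITIAL FORM and `g ∈ F′(ε)[x]` VANISHING BELOW `ldeg E`: the model is
`E = N̂_{i₀} · ∏_i D̂_i` (models of the cleared numerator of the divisor and of all cleared
denominators), and every summand of `g` has `ldeg ≥ (c_{i₀} + e) + Σ_i c_i = ldeg E` because all
terms have the same excess. These are exactly the hypotheses `hE`, `hmod`, `hM` of
`EpsLim.exists_model_of_mul_intToFrac` / `EpsLim.gradeZero_of_model`.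
[cite: DuttaDwivediSaxena2022, Claim 3.8 with proof (full version p0035 L934–939); §3 induction hypothesis (3) (p0030 L804–805)] -/
theorem exists_stage_model (hinj : Function.Injective (algebraMap (MvPolynomial (Fin n) F) F'))
    {m e : ℕ} {G : Fin (m + 1) → ExactTerm (RatFunc F') n} (hWF : ∀ i, (G i).WF) {i₀ : Fin (m + 1)}
    (hND : (G i₀).ND)
    (hcomp : StageComp (ratFuncMap (algebraMap F F'))
      (fun m => algebraMap F' (RatFunc F') (algebraMap (MvPolynomial (Fin n) F) F' (X m))) e G) :
    ∃ (E : MvPolynomial (Fin n) F'[X]) (g : MvPolynomial (Fin n) (RatFunc F')),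
      redZero F' (Fin n) (initialForm E) ≠ 0 ∧
      (∑ i, (G i).val) / (G i₀).val * intToFrac F' (Fin n) E =
        algebraMap (MvPolynomial (Fin n) (RatFunc F')) (FractionRing (MvPolynomial (Fin n) (RatFunc F'))) g ∧
      ∀ d : Fin n →₀ ℕ, d.degree < ldeg E → coeff d g = 0 := by
  classical
  -- companions, weights
  choose c hc using hcomp
  -- models of the cleared denominators
  have hden : ∀ i, ∃ (t : RatFunc F') (D : MvPolynomial (Fin n) F'[X]), t ≠ 0 ∧
      (G i).denPoly = C t * map (algebraMap F'[X] (RatFunc F')) D ∧ ldeg D = c i ∧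
      redZero F' (Fin n) (initialForm D) ≠ 0 := fun i =>
    (hc i).denPoly.exists_model hinj ((G i).denPoly_ne_zero (hWF i))
  choose t D ht hDeq hDl hDred using hden
  -- model of the cleared numerator of the divisor
  obtain ⟨N', hN', hnum₀⟩ := (hc i₀).numPoly
  have hN'0 : N' ≠ 0 := by
    intro h
    apply (G i₀).numPoly_ne_zero hND
    rw [hnum₀, h, mul_zero]
  obtain ⟨s, N, hs, hN'eq, hNl, hNred⟩ := hN'.exists_model hinj hN'0
  -- nonvanishing bookkeeping
  have hN0 : N ≠ 0 := fun h => hNred (by rw [h, initialForm, map_zero, map_zero])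
  have hD0 : ∀ i, D i ≠ 0 := fun i h => hDred i (by rw [h, initialForm, map_zero, map_zero])
  have hκ₀ : (G i₀).A.κ ≠ 0 := (G i₀).A.hκ
  refine ⟨N * ∏ i, D i,
    ∑ i, C (((G i₀).A.κ * s * t i)⁻¹) * ((G i).numPoly * (G i₀).denPoly *
      ∏ i' ∈ Finset.univ.erase i, map (algebraMap F'[X] (RatFunc F')) (D i')), ?_, ?_, ?_⟩
  · -- `ε`-unit initial form
    exact redZero_initialForm_mul_ne_zero hNred
      (redZero_initialForm_prod_ne_zero Finset.univ fun i _ => hDred i)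
  · -- the identity in `F′(ε)(x)`
    set am := algebraMap (MvPolynomial (Fin n) (RatFunc F'))
      (FractionRing (MvPolynomial (Fin n) (RatFunc F'))) with ham
    have hT0 : (G i₀).val ≠ 0 := (G i₀).val_ne_zero (hWF i₀) hND
    have hval : ∀ i, (G i).val = am (G i).numPoly / am (G i).denPoly := fun i =>
      (G i).val_eq_numPoly_div_denPoly (hWF i)
    have hE : intToFrac F' (Fin n) (N * ∏ i, D i) =
        am (map (algebraMap F'[X] (RatFunc F')) N) *
          ∏ i, am (map (algebraMap F'[X] (RatFunc F')) (D i)) := by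
      rw [intToFrac_apply, map_mul, map_prod, map_mul, map_prod]
    rw [div_mul_eq_mul_div, div_eq_iff hT0, map_sum, Finset.sum_mul, Finset.sum_mul]
    refine Finset.sum_congr rfl fun i _ => ?_
    -- per-summand identity
    have hdi : am (G i).denPoly ≠ 0 := algebraMap_frac_ne_zero ((G i).denPoly_ne_zero (hWF i))
    have hd₀ : am (G i₀).denPoly ≠ 0 := algebraMap_frac_ne_zero ((G i₀).denPoly_ne_zero (hWF i₀))
    have hn₀ : am (G i₀).numPoly ≠ 0 := algebraMap_frac_ne_zero ((G i₀).numPoly_ne_zero hND)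
    have hti : am (C (t i)) ≠ 0 := algebraMap_frac_ne_zero (C_eq_zero.not.mpr (ht i))
    have hκs : am (C ((G i₀).A.κ * s)) ≠ 0 :=
      algebraMap_frac_ne_zero (C_eq_zero.not.mpr (mul_ne_zero hκ₀ hs))
    have hDi : am (map (algebraMap F'[X] (RatFunc F')) (D i)) ≠ 0 :=
      algebraMap_frac_ne_zero fun h => hD0 i
        (map_injective _ (RatFunc.algebraMap_injective F') (by rw [h, map_zero]))
    have hnum₀' : am (G i₀).numPoly = am (C ((G i₀).A.κ * s)) *
        am (map (algebraMap F'[X] (RatFunc F')) N) := by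
      rw [hnum₀, hN'eq, ← mul_assoc, ← C_mul, map_mul]
    have hdeni : am (G i).denPoly = am (C (t i)) * am (map (algebraMap F'[X] (RatFunc F')) (D i)) := by
      rw [hDeq i, map_mul]
    have hprod : ∏ i', am (map (algebraMap F'[X] (RatFunc F')) (D i')) =
        am (map (algebraMap F'[X] (RatFunc F')) (D i)) *
          ∏ i' ∈ Finset.univ.erase i, am (map (algebraMap F'[X] (RatFunc F')) (D i')) :=
      (Finset.mul_prod_erase _ _ (Finset.mem_univ i)).symm
    have hw : am (C (((G i₀).A.κ * s * t i)⁻¹)) = (am (C ((G i₀).A.κ * s)) * am (C (t i)))⁻¹ := by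
      rw [← map_mul, ← C_mul, ← RingHom.comp_apply, map_inv₀, RingHom.comp_apply]
    rw [hval i, hval i₀, hE, hprod]
    simp only [map_mul am, map_prod am]
    rw [hnum₀', hdeni, hw]
    field_simp
  · -- vanishing below `ldeg E = (c i₀ + e) + Σ_i c i`
    have hlE : ldeg (N * ∏ i, D i) = (c i₀ + e) + ∑ i, c i := by
      rw [ldeg_mul hN0 (Finset.prod_ne_zero_iff.mpr fun i _ => hD0 i), hNl,
        ldeg_prod _ _ fun i _ => hD0 i]
      simp only [hDl]
    rw [hlE]
    refine vanishing_sum _ _ fun i _ => vanishing_C_mul _ ?_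
    -- `numPoly i` vanishes below `c i + e`, `denPoly i₀` below `c i₀`, each `D i'` below `c i'`
    have h1 : ∀ d : Fin n →₀ ℕ, d.degree < c i + e → coeff d (G i).numPoly = 0 := by
      obtain ⟨Ni, hNi, hnumi⟩ := (hc i).numPoly
      rw [hnumi]
      exact vanishing_C_mul _ hNi.vanishing
    have h2 : ∀ d : Fin n →₀ ℕ, d.degree < c i₀ → coeff d (G i₀).denPoly = 0 :=
      (hc i₀).denPoly.vanishing
    have h3 : ∀ d : Fin n →₀ ℕ, d.degree < ∑ i' ∈ Finset.univ.erase i, c i' →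
        coeff d (∏ i' ∈ Finset.univ.erase i, map (algebraMap F'[X] (RatFunc F')) (D i')) = 0 :=
      vanishing_prod _ _ _ fun i' _ => by
        rw [← hDl i', ← ldeg_map_of_injective (RatFunc.algebraMap_injective F') (D i')]
        exact vanishing_ldeg _
    have h := coeff_mul_eq_zero_of_vanishing (coeff_mul_eq_zero_of_vanishing h1 h2) h3
    have hsum : c i + e + c i₀ + ∑ i' ∈ Finset.univ.erase i, c i' = c i₀ + e + ∑ i', c i' := by
      rw [← Finset.add_sum_erase _ _ (Finset.mem_univ i)]
      ring
    rw [← hsum]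
    exact h

/-- ★★ **`lim_{ε→0}` COMMUTES WITH `·|_{z=0}` ON THE STAGE RATIO (Claim 3.8, first displayed
equality, for the objects B4b builds).** For a stage family as in `exists_stage_model` and ANY
scalar `λ ∈ F′(ε)` (the rescaling `λ_{j+1}` of `DDS21DiDILExactChain` §4): if
`Y = λ · (Σ_i T_i)/T_{i₀}` has a limit `r`, then `Y|_{z=0}` has the limit `r|_{z=0}`.
[cite: DuttaDwivediSaxena2022, Claim 3.8 with proof, "(f_j/t_{k−j,j})|_{z=0} = lim_{ε→0} Σ_i (T_{i,j}/T̃_{k−j,j})|_{z=0}" (full version p0035 L934–939)] -/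
theorem epsLim_gradeZero_stage (hinj : Function.Injective (algebraMap (MvPolynomial (Fin n) F) F'))
    {m e : ℕ} {G : Fin (m + 1) → ExactTerm (RatFunc F') n} (hWF : ∀ i, (G i).WF) {i₀ : Fin (m + 1)}
    (hND : (G i₀).ND)
    (hcomp : StageComp (ratFuncMap (algebraMap F F'))
      (fun m => algebraMap F' (RatFunc F') (algebraMap (MvPolynomial (Fin n) F) F' (X m))) e G)
    (lam : RatFunc F') {r : FractionRing (MvPolynomial (Fin n) F')}
    (hY : EpsLim (algebraMap (RatFunc F') (FractionRing (MvPolynomial (Fin n) (RatFunc F'))) lam *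
      ((∑ i, (G i).val) / (G i₀).val)) r)
    {w : FractionRing (MvPolynomial (Fin n) (RatFunc F'))} {w₀ : FractionRing (MvPolynomial (Fin n) F')}
    (hw : GradeZero (algebraMap (RatFunc F') (FractionRing (MvPolynomial (Fin n) (RatFunc F'))) lam *
      ((∑ i, (G i).val) / (G i₀).val)) w)
    (hw₀ : GradeZero r w₀) : EpsLim w w₀ := by
  obtain ⟨E, g, hE, hmod, hg⟩ := exists_stage_model hinj hWF hND hcomp
  set Y := algebraMap (RatFunc F') (FractionRing (MvPolynomial (Fin n) (RatFunc F'))) lam *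
      ((∑ i, (G i).val) / (G i₀).val) with hYdef
  have hE0 : E ≠ 0 := fun h => hE (by rw [h, initialForm, map_zero, map_zero])
  -- `Y · E = ι(C λ · g)`
  have hmod' : Y * intToFrac F' (Fin n) E =
      algebraMap (MvPolynomial (Fin n) (RatFunc F')) (FractionRing (MvPolynomial (Fin n) (RatFunc F')))
        (C lam * g) := by
    rw [hYdef, mul_assoc, hmod, map_mul,
      IsScalarTower.algebraMap_apply (RatFunc F') (MvPolynomial (Fin n) (RatFunc F'))
        (FractionRing (MvPolynomial (Fin n) (RatFunc F'))) lam, MvPolynomial.algebraMap_eq]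
  -- Gauss: an integral model `(C q · E, Ĝ)` with `q(0) ≠ 0`
  obtain ⟨q, Gh, hq, hGh⟩ := hY.exists_model_of_mul_intToFrac hmod'
  have hq0 : (C q : MvPolynomial (Fin n) F'[X]) ≠ 0 :=
    C_eq_zero.not.mpr fun h => hq (by rw [h, Polynomial.coeff_zero])
  -- its initial form is still an `ε`-unit, its lowest degree is `ldeg E`
  have hinE : initialForm (C q * E) = C q * initialForm E := by
    rw [initialForm_mul, initialForm_eq_self_of_isHomogeneous (isHomogeneous_C _ q) hq0]
  have hE' : redZero F' (Fin n) (initialForm (C q * E)) ≠ 0 := by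
    rw [hinE, map_mul, redZero_apply, map_C]
    exact mul_ne_zero (C_eq_zero.not.mpr (by rwa [Polynomial.constantCoeff_apply])) hE
  have hlE : ldeg (C q * E) = ldeg E := by
    rw [ldeg_mul hq0 hE0, ldeg_C, zero_add]
  -- `Ĝ` vanishes below `ldeg E`: `ι(Ĝ) = C(ι q · λ) · g`
  have hGh' : map (algebraMap F'[X] (RatFunc F')) Gh = C (algebraMap F'[X] (RatFunc F') q * lam) * g := by
    apply algebraMap_frac_injective
    rw [← intToFrac_apply, ← hGh, map_mul (intToFrac F' (Fin n)), ← mul_assoc, mul_comm Y, mul_assoc,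
      hmod', intToFrac_apply, map_C, ← map_mul, ← mul_assoc, ← C_mul]
  have hM : ∀ d : Fin n →₀ ℕ, d.degree < ldeg (C q * E) → coeff d Gh = 0 := by
    intro d hd
    rw [hlE] at hd
    have h := vanishing_C_mul (algebraMap F'[X] (RatFunc F') q * lam) hg d hd
    rw [← hGh', coeff_map] at h
    exact RatFunc.algebraMap_injective F' (by rw [h, map_zero])
  exact hY.gradeZero_of_model hE' hGh hM hw hw₀

/-- **The integral model of the (rescaled) stage ratio.** Under the hypotheses of
`epsLim_gradeZero_stage`, `Y = λ · (Σ_i T_i)/T_{i₀}` is `M/E` with `M, E ∈ F′[ε][x]`, `E` of `ε`-unit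
initial form and `M` vanishing below `ldeg E` ("`g_j/T̃_{k−j,j} ∈ F(x)[[z, ε]]`") — the stage model
followed by the Gauss lemma `EpsLim.exists_model_of_mul_intToFrac`.
[cite: DuttaDwivediSaxena2022, Claim 3.8 proof "as the valuation with respect to z and ε is non-negative" (full version p0035 L934–936)] -/
theorem exists_intModel_stage (hinj : Function.Injective (algebraMap (MvPolynomial (Fin n) F) F'))
    {m e : ℕ} {G : Fin (m + 1) → ExactTerm (RatFunc F') n} (hWF : ∀ i, (G i).WF) {i₀ : Fin (m + 1)}
    (hND : (G i₀).ND)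
    (hcomp : StageComp (ratFuncMap (algebraMap F F'))
      (fun m => algebraMap F' (RatFunc F') (algebraMap (MvPolynomial (Fin n) F) F' (X m))) e G)
    (lam : RatFunc F') {r : FractionRing (MvPolynomial (Fin n) F')}
    (hY : EpsLim (algebraMap (RatFunc F') (FractionRing (MvPolynomial (Fin n) (RatFunc F'))) lam *
      ((∑ i, (G i).val) / (G i₀).val)) r) :
    ∃ E M : MvPolynomial (Fin n) F'[X], redZero F' (Fin n) (initialForm E) ≠ 0 ∧
      algebraMap (RatFunc F') (FractionRing (MvPolynomial (Fin n) (RatFunc F'))) lam *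
          ((∑ i, (G i).val) / (G i₀).val) * intToFrac F' (Fin n) E = intToFrac F' (Fin n) M ∧
      ∀ d : Fin n →₀ ℕ, d.degree < ldeg E → coeff d M = 0 := by
  obtain ⟨E, g, hE, hmod, hg⟩ := exists_stage_model hinj hWF hND hcomp
  set Y := algebraMap (RatFunc F') (FractionRing (MvPolynomial (Fin n) (RatFunc F'))) lam *
      ((∑ i, (G i).val) / (G i₀).val) with hYdef
  have hE0 : E ≠ 0 := fun h => hE (by rw [h, initialForm, map_zero, map_zero])
  have hmod' : Y * intToFrac F' (Fin n) E =
      algebraMap (MvPolynomial (Fin n) (RatFunc F')) (FractionRing (MvPolynomial (Fin n) (RatFunc F')))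
        (C lam * g) := by
    rw [hYdef, mul_assoc, hmod, map_mul,
      IsScalarTower.algebraMap_apply (RatFunc F') (MvPolynomial (Fin n) (RatFunc F'))
        (FractionRing (MvPolynomial (Fin n) (RatFunc F'))) lam, MvPolynomial.algebraMap_eq]
  obtain ⟨q, Gh, hq, hGh⟩ := hY.exists_model_of_mul_intToFrac hmod'
  have hq0 : (C q : MvPolynomial (Fin n) F'[X]) ≠ 0 :=
    C_eq_zero.not.mpr fun h => hq (by rw [h, Polynomial.coeff_zero])
  have hinE : initialForm (C q * E) = C q * initialForm E := by
    rw [initialForm_mul, initialForm_eq_self_of_isHomogeneous (isHomogeneous_C _ q) hq0]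
  have hE' : redZero F' (Fin n) (initialForm (C q * E)) ≠ 0 := by
    rw [hinE, map_mul, redZero_apply, map_C]
    exact mul_ne_zero (C_eq_zero.not.mpr (by rwa [Polynomial.constantCoeff_apply])) hE
  have hlE : ldeg (C q * E) = ldeg E := by
    rw [ldeg_mul hq0 hE0, ldeg_C, zero_add]
  have hGh' : map (algebraMap F'[X] (RatFunc F')) Gh = C (algebraMap F'[X] (RatFunc F') q * lam) * g := by
    apply algebraMap_frac_injective
    rw [← intToFrac_apply, ← hGh, map_mul (intToFrac F' (Fin n)), ← mul_assoc, mul_comm Y, mul_assoc,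
      hmod', intToFrac_apply, map_C, ← map_mul, ← mul_assoc, ← C_mul]
  have hM : ∀ d : Fin n →₀ ℕ, d.degree < ldeg (C q * E) → coeff d Gh = 0 := by
    intro d hd
    rw [hlE] at hd
    have h := vanishing_C_mul (algebraMap F'[X] (RatFunc F') q * lam) hg d hd
    rw [← hGh', coeff_map] at h
    exact RatFunc.algebraMap_injective F' (by rw [h, map_zero])
  exact ⟨C q * E, Gh, hE', hGh, hM⟩

/-- **`Y|_{z=0}` exists** for the rescaled stage ratio (its `z`-valuation is `≥ 0`).
[cite: DuttaDwivediSaxena2022, Claim 3.8 proof (full version p0035 L934–936)] -/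
theorem exists_gradeZero_stage (hinj : Function.Injective (algebraMap (MvPolynomial (Fin n) F) F'))
    {m e : ℕ} {G : Fin (m + 1) → ExactTerm (RatFunc F') n} (hWF : ∀ i, (G i).WF) {i₀ : Fin (m + 1)}
    (hND : (G i₀).ND)
    (hcomp : StageComp (ratFuncMap (algebraMap F F'))
      (fun m => algebraMap F' (RatFunc F') (algebraMap (MvPolynomial (Fin n) F) F' (X m))) e G)
    (lam : RatFunc F') {r : FractionRing (MvPolynomial (Fin n) F')}
    (hY : EpsLim (algebraMap (RatFunc F') (FractionRing (MvPolynomial (Fin n) (RatFunc F'))) lam *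
      ((∑ i, (G i).val) / (G i₀).val)) r) :
    ∃ w, GradeZero (algebraMap (RatFunc F') (FractionRing (MvPolynomial (Fin n) (RatFunc F'))) lam *
      ((∑ i, (G i).val) / (G i₀).val)) w := by
  obtain ⟨E, M, hE, hmod, hM⟩ := exists_intModel_stage hinj hWF hND hcomp lam hY
  have hE0 : E ≠ 0 := fun h => hE (by rw [h, initialForm, map_zero, map_zero])
  exact ⟨_, gradeZero_of_intModel hE0 hmod hM⟩

/-- ★ **`(lim Y)|_{z=0}` exists** for the limit `r = f_j/u_j` of the rescaled stage ratio — the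
well-definedness of "`(f_j/t_{k−j,j})|_{z=0}`" in Claim 3.8 — with the witness read off the
integral model (`gradeZero_lim_of_intModel`); unique by `GradeZero.unique`.
[cite: DuttaDwivediSaxena2022, Claim 3.8 (full version p0035 L934–939)] -/
theorem exists_gradeZero_lim_stage
    (hinj : Function.Injective (algebraMap (MvPolynomial (Fin n) F) F'))
    {m e : ℕ} {G : Fin (m + 1) → ExactTerm (RatFunc F') n} (hWF : ∀ i, (G i).WF) {i₀ : Fin (m + 1)}
    (hND : (G i₀).ND)
    (hcomp : StageComp (ratFuncMap (algebraMap F F'))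
      (fun m => algebraMap F' (RatFunc F') (algebraMap (MvPolynomial (Fin n) F) F' (X m))) e G)
    (lam : RatFunc F') {r : FractionRing (MvPolynomial (Fin n) F')}
    (hY : EpsLim (algebraMap (RatFunc F') (FractionRing (MvPolynomial (Fin n) (RatFunc F'))) lam *
      ((∑ i, (G i).val) / (G i₀).val)) r) :
    ∃ w₀, GradeZero r w₀ := by
  obtain ⟨E, M, hE, hmod, hM⟩ := exists_intModel_stage hinj hWF hND hcomp lam hY
  exact ⟨_, gradeZero_lim_of_intModel hY hE hmod hM⟩

/-- `exists_intModel_stage` in the currency `(λ · Σ_i T_i) / T_{i₀}` of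
`DDS21TranscriptResidues.didil_round` (same element, `mul_div_assoc`).
[cite: DuttaDwivediSaxena2022, Claim 3.8 proof (full version p0035 L934–936)] -/
theorem exists_intModel_stage' (hinj : Function.Injective (algebraMap (MvPolynomial (Fin n) F) F'))
    {m e : ℕ} {G : Fin (m + 1) → ExactTerm (RatFunc F') n} (hWF : ∀ i, (G i).WF) {i₀ : Fin (m + 1)}
    (hND : (G i₀).ND)
    (hcomp : StageComp (ratFuncMap (algebraMap F F'))
      (fun m => algebraMap F' (RatFunc F') (algebraMap (MvPolynomial (Fin n) F) F' (X m))) e G)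
    (lam : RatFunc F') {r : FractionRing (MvPolynomial (Fin n) F')}
    (hY : EpsLim (algebraMap (RatFunc F') (FractionRing (MvPolynomial (Fin n) (RatFunc F'))) lam *
      (∑ i, (G i).val) / (G i₀).val) r) :
    ∃ E M : MvPolynomial (Fin n) F'[X], redZero F' (Fin n) (initialForm E) ≠ 0 ∧
      algebraMap (RatFunc F') (FractionRing (MvPolynomial (Fin n) (RatFunc F'))) lam *
          (∑ i, (G i).val) / (G i₀).val * intToFrac F' (Fin n) E = intToFrac F' (Fin n) M ∧
      ∀ d : Fin n →₀ ℕ, d.degree < ldeg E → coeff d M = 0 := by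
  rw [mul_div_assoc] at hY ⊢
  exact exists_intModel_stage hinj hWF hND hcomp lam hY

/-- `exists_gradeZero_stage` in the currency `(λ · Σ_i T_i) / T_{i₀}`.
[cite: DuttaDwivediSaxena2022, Claim 3.8 proof (full version p0035 L934–936)] -/
theorem exists_gradeZero_stage' (hinj : Function.Injective (algebraMap (MvPolynomial (Fin n) F) F'))
    {m e : ℕ} {G : Fin (m + 1) → ExactTerm (RatFunc F') n} (hWF : ∀ i, (G i).WF) {i₀ : Fin (m + 1)}
    (hND : (G i₀).ND)
    (hcomp : StageComp (ratFuncMap (algebraMap F F'))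
      (fun m => algebraMap F' (RatFunc F') (algebraMap (MvPolynomial (Fin n) F) F' (X m))) e G)
    (lam : RatFunc F') {r : FractionRing (MvPolynomial (Fin n) F')}
    (hY : EpsLim (algebraMap (RatFunc F') (FractionRing (MvPolynomial (Fin n) (RatFunc F'))) lam *
      (∑ i, (G i).val) / (G i₀).val) r) :
    ∃ w, GradeZero (algebraMap (RatFunc F') (FractionRing (MvPolynomial (Fin n) (RatFunc F'))) lam *
      (∑ i, (G i).val) / (G i₀).val) w := by
  rw [mul_div_assoc] at hY ⊢
  exact exists_gradeZero_stage hinj hWF hND hcomp lam hY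

/-- `exists_gradeZero_lim_stage` in the currency `(λ · Σ_i T_i) / T_{i₀}`.
[cite: DuttaDwivediSaxena2022, Claim 3.8 (full version p0035 L934–939)] -/
theorem exists_gradeZero_lim_stage'
    (hinj : Function.Injective (algebraMap (MvPolynomial (Fin n) F) F'))
    {m e : ℕ} {G : Fin (m + 1) → ExactTerm (RatFunc F') n} (hWF : ∀ i, (G i).WF) {i₀ : Fin (m + 1)}
    (hND : (G i₀).ND)
    (hcomp : StageComp (ratFuncMap (algebraMap F F'))
      (fun m => algebraMap F' (RatFunc F') (algebraMap (MvPolynomial (Fin n) F) F' (X m))) e G)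
    (lam : RatFunc F') {r : FractionRing (MvPolynomial (Fin n) F')}
    (hY : EpsLim (algebraMap (RatFunc F') (FractionRing (MvPolynomial (Fin n) (RatFunc F'))) lam *
      (∑ i, (G i).val) / (G i₀).val) r) :
    ∃ w₀, GradeZero r w₀ := by
  rw [mul_div_assoc] at hY
  exact exists_gradeZero_lim_stage hinj hWF hND hcomp lam hY

/-- ★★ `epsLim_gradeZero_stage` in the currency `(λ · Σ_i T_i) / T_{i₀}` of
`DDS21TranscriptResidues.didil_round` / `exists_didil_run`.
[cite: DuttaDwivediSaxena2022, Claim 3.8 with proof (full version p0035 L934–939)] -/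
theorem epsLim_gradeZero_stage' (hinj : Function.Injective (algebraMap (MvPolynomial (Fin n) F) F'))
    {m e : ℕ} {G : Fin (m + 1) → ExactTerm (RatFunc F') n} (hWF : ∀ i, (G i).WF) {i₀ : Fin (m + 1)}
    (hND : (G i₀).ND)
    (hcomp : StageComp (ratFuncMap (algebraMap F F'))
      (fun m => algebraMap F' (RatFunc F') (algebraMap (MvPolynomial (Fin n) F) F' (X m))) e G)
    (lam : RatFunc F') {r : FractionRing (MvPolynomial (Fin n) F')}
    (hY : EpsLim (algebraMap (RatFunc F') (FractionRing (MvPolynomial (Fin n) (RatFunc F'))) lam *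
      (∑ i, (G i).val) / (G i₀).val) r)
    {w : FractionRing (MvPolynomial (Fin n) (RatFunc F'))} {w₀ : FractionRing (MvPolynomial (Fin n) F')}
    (hw : GradeZero (algebraMap (RatFunc F') (FractionRing (MvPolynomial (Fin n) (RatFunc F'))) lam *
      (∑ i, (G i).val) / (G i₀).val) w)
    (hw₀ : GradeZero r w₀) : EpsLim w w₀ := by
  rw [mul_div_assoc] at hY hw
  exact epsLim_gradeZero_stage hinj hWF hND hcomp lam hY hw hw₀

/-- Transfer of the graded valuation between two representative pairs of the same nonzero
fraction: `tn/td = N₀/D₀` with all four nonzero ⇒ `ldeg tn + ldeg D₀ = ldeg N₀ + ldeg td`. (folklore)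
[cite: DuttaDwivediSaxena2022, §3 induction hypothesis (3) (full version p0030 L804–805)] -/
theorem ldeg_add_eq_of_cross {K : Type*} [Field K] {σ : Type*} {tn td N₀ D₀ : MvPolynomial σ K}
    (htn : tn ≠ 0) (htd : td ≠ 0) (hN : N₀ ≠ 0) (hD : D₀ ≠ 0) (h : tn * D₀ = N₀ * td) :
    ldeg tn + ldeg D₀ = ldeg N₀ + ldeg td := by
  rw [← ldeg_mul htn hD, ← ldeg_mul hN htd, h]

/-- ★ **The divisor's limit has graded valuation EXACTLY the excess** (`val_z(t_{k−j,j}) = [j ≥ 1]`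
generically; print: "`v_{k−j,j} = min_i v_{i,j}`" and `d_{j+1} := d_j − v_{k−j,j} − 1`). For the
divisor `T_{i₀} = c · U` of a companion stage (any normalisation with `lim U = u ≠ 0`, e.g.
`DDS21DiDILExactChain.exists_unit_divisor`): `u = tn/td` with `tn, td ∈ F′[x]` nonzero and
`ldeg tn = ldeg td + e`. (The graded valuation of a nonzero fraction does not depend on the
representatives: cross-multiply and use `ldeg_mul`.)
[cite: DuttaDwivediSaxena2022, §3 induction hypothesis (3) and "Definability" `d_{j+1} := d_j − v_{k−j,j} − 1` (full version p0030 L804–805, p0031 L815–817)] -/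
theorem exists_divisor_limit_ldeg
    (hinj : Function.Injective (algebraMap (MvPolynomial (Fin n) F) F'))
    {m e : ℕ} {G : Fin (m + 1) → ExactTerm (RatFunc F') n} (hWF : ∀ i, (G i).WF) {i₀ : Fin (m + 1)}
    (hND : (G i₀).ND)
    (hcomp : StageComp (ratFuncMap (algebraMap F F'))
      (fun m => algebraMap F' (RatFunc F') (algebraMap (MvPolynomial (Fin n) F) F' (X m))) e G)
    {c : RatFunc F'} {U : FractionRing (MvPolynomial (Fin n) (RatFunc F'))}
    {u : FractionRing (MvPolynomial (Fin n) F')}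
    (hU : (G i₀).val = algebraMap (RatFunc F') (FractionRing (MvPolynomial (Fin n) (RatFunc F'))) c * U)
    (hu : EpsLim U u) (hu0 : u ≠ 0) :
    ∃ tn td : MvPolynomial (Fin n) F', tn ≠ 0 ∧ td ≠ 0 ∧
      u * limToFrac F' (Fin n) td = limToFrac F' (Fin n) tn ∧ ldeg tn = ldeg td + e := by
  obtain ⟨c₀, hc₀⟩ := hcomp i₀
  -- models of the divisor's cleared numerator and denominator
  obtain ⟨N', hN', hnum₀⟩ := hc₀.numPoly
  have hN'0 : N' ≠ 0 := by
    intro h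
    apply (G i₀).numPoly_ne_zero hND
    rw [hnum₀, h, mul_zero]
  obtain ⟨s, N, hs, hN'eq, hNl, hNred⟩ := hN'.exists_model hinj hN'0
  obtain ⟨t, D, ht, hDeq, hDl, hDred⟩ := hc₀.denPoly.exists_model hinj ((G i₀).denPoly_ne_zero (hWF i₀))
  have hNr : redZero F' (Fin n) N ≠ 0 := redZero_ne_zero_of_initialForm hNred
  have hDr : redZero F' (Fin n) D ≠ 0 := redZero_ne_zero_of_initialForm hDred
  have hκ₀ : (G i₀).A.κ ≠ 0 := (G i₀).A.hκ
  have hc : c ≠ 0 := by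
    intro h
    apply (G i₀).val_ne_zero (hWF i₀) hND
    rw [hU, h, map_zero, zero_mul]
  set am := algebraMap (MvPolynomial (Fin n) (RatFunc F'))
    (FractionRing (MvPolynomial (Fin n) (RatFunc F'))) with ham
  -- `U · ι(D) = ι(C μ · N)` with `μ = c⁻¹ κ s / t`
  have hUD : U * intToFrac F' (Fin n) D =
      am (C (c⁻¹ * ((G i₀).A.κ * s) * t⁻¹) * map (algebraMap F'[X] (RatFunc F')) N) := by
    have hval := (G i₀).val_eq_numPoly_div_denPoly (hWF i₀)
    rw [hU, hnum₀, hN'eq, hDeq, ← mul_assoc, ← C_mul] at hval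
    have hc' : algebraMap (RatFunc F') (FractionRing (MvPolynomial (Fin n) (RatFunc F'))) c ≠ 0 := by
      rw [IsScalarTower.algebraMap_apply (RatFunc F') (MvPolynomial (Fin n) (RatFunc F'))
        (FractionRing (MvPolynomial (Fin n) (RatFunc F')))]
      exact algebraMap_frac_ne_zero (C_eq_zero.not.mpr hc)
    have ht' : am (C t) ≠ 0 := algebraMap_frac_ne_zero (C_eq_zero.not.mpr ht)
    have hD' : am (map (algebraMap F'[X] (RatFunc F')) D) ≠ 0 :=
      algebraMap_frac_ne_zero fun h => hDr (by
        have hD0 : D = 0 := map_injective _ (RatFunc.algebraMap_injective F') (by rw [h, map_zero])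
        rw [hD0, map_zero])
    have hU' : U = (algebraMap (RatFunc F') (FractionRing (MvPolynomial (Fin n) (RatFunc F'))) c)⁻¹ *
        (am (C ((G i₀).A.κ * s) * map (algebraMap F'[X] (RatFunc F')) N) /
          am (C t * map (algebraMap F'[X] (RatFunc F')) D)) := by
      rw [← hval, ← mul_assoc, inv_mul_cancel₀ hc', one_mul]
    rw [hU', intToFrac_apply, IsScalarTower.algebraMap_apply (RatFunc F') (MvPolynomial (Fin n) (RatFunc F'))
      (FractionRing (MvPolynomial (Fin n) (RatFunc F'))) c, MvPolynomial.algebraMap_eq]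
    have hcC : am (C c) ≠ 0 := algebraMap_frac_ne_zero (C_eq_zero.not.mpr hc)
    have hinvC : (am (C c))⁻¹ = am (C c⁻¹) := by
      rw [← RingHom.comp_apply, ← RingHom.comp_apply, map_inv₀]
    have hinvt : am (C t⁻¹) = (am (C t))⁻¹ := by
      rw [← RingHom.comp_apply, ← RingHom.comp_apply, map_inv₀]
    rw [hinvC, ← ham]
    simp only [map_mul am, C_mul, hinvt]
    field_simp
  -- the limit of `U · ι(D)` two ways
  have hlim : EpsLim (U * intToFrac F' (Fin n) D) (u * limToFrac F' (Fin n) (redZero F' (Fin n) D)) :=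
    hu.mul (epsLim_intToFrac D)
  rw [hUD] at hlim
  have hμ : c⁻¹ * ((G i₀).A.κ * s) * t⁻¹ ≠ 0 :=
    mul_ne_zero (mul_ne_zero (inv_ne_zero hc) (mul_ne_zero hκ₀ hs)) (inv_ne_zero ht)
  obtain ⟨a, ha, ha0⟩ := EpsLim.exists_eq_C_mul_of_normalForm hμ hNr hlim
  have hu' : u * limToFrac F' (Fin n) (redZero F' (Fin n) D) ≠ 0 :=
    mul_ne_zero hu0 (limToFrac_ne_zero hDr)
  have ha' : a ≠ 0 := ha0 hu'
  refine ⟨C a * redZero F' (Fin n) N, redZero F' (Fin n) D,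
    mul_ne_zero (C_eq_zero.not.mpr ha') hNr, hDr, ha, ?_⟩
  -- lowest degrees: `ldeg (N(0)) = ldeg N = c₀ + e`, `ldeg (D(0)) = ldeg D = c₀`
  have hlN : ldeg (redZero F' (Fin n) N) = ldeg N := by
    rw [redZero_apply]
    exact ldeg_map_eq_of_ne_zero _ (by rwa [← redZero_apply])
  have hlD : ldeg (redZero F' (Fin n) D) = ldeg D := by
    rw [redZero_apply]
    exact ldeg_map_eq_of_ne_zero _ (by rwa [← redZero_apply])
  rw [ldeg_mul (C_eq_zero.not.mpr ha') hNr, ldeg_C, zero_add, hlN, hlD, hNl, hDl, add_comm]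

/-! ### The `z = 0` pieces of Claim 3.8: `(T_{i,j}/T̃_{k−j,j})|_{z=0}` term by term -/

/-- At the transcendental point the cleared denominator of a companion term has lowest degree
EXACTLY its weight `b`. [cite: DuttaDwivediSaxena2022, §3 induction hypothesis (3) (full version p0030 L804–805)] -/
theorem ExactTerm.Companion.ldeg_denPoly
    (hinj : Function.Injective (algebraMap (MvPolynomial (Fin n) F) F'))
    {a b : ℕ} {T : ExactTerm (RatFunc F') n}
    (h : ExactTerm.Companion (ratFuncMap (algebraMap F F'))
      (fun m => algebraMap F' (RatFunc F') (algebraMap (MvPolynomial (Fin n) F) F' (X m))) a b T)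
    (hWF : T.WF) : ldeg T.denPoly = b := by
  obtain ⟨t, D, ht, hDeq, hDl, -⟩ := h.denPoly.exists_model hinj (T.denPoly_ne_zero hWF)
  have hD0 : map (algebraMap F'[X] (RatFunc F')) D ≠ 0 := by
    intro h0
    apply T.denPoly_ne_zero hWF
    rw [hDeq, h0, mul_zero]
  rw [hDeq, ldeg_mul (C_eq_zero.not.mpr ht) hD0, ldeg_C, zero_add,
    ldeg_map_of_injective (RatFunc.algebraMap_injective F'), hDl]

/-- At the transcendental point the cleared numerator of a NONDEGENERATE companion term has lowest
degree EXACTLY its weight `a` (so `val_z(T) = a − b`).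
[cite: DuttaDwivediSaxena2022, §3 induction hypothesis (3) (full version p0030 L804–805)] -/
theorem ExactTerm.Companion.ldeg_numPoly
    (hinj : Function.Injective (algebraMap (MvPolynomial (Fin n) F) F'))
    {a b : ℕ} {T : ExactTerm (RatFunc F') n}
    (h : ExactTerm.Companion (ratFuncMap (algebraMap F F'))
      (fun m => algebraMap F' (RatFunc F') (algebraMap (MvPolynomial (Fin n) F) F' (X m))) a b T)
    (hND : T.ND) : ldeg T.numPoly = a := by
  obtain ⟨N', hN', hnum⟩ := h.numPoly
  have hN'0 : N' ≠ 0 := by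
    intro h0
    apply T.numPoly_ne_zero hND
    rw [hnum, h0, mul_zero]
  obtain ⟨s, N, hs, hNeq, hNl, -⟩ := hN'.exists_model hinj hN'0
  have hN0 : map (algebraMap F'[X] (RatFunc F')) N ≠ 0 := by
    intro h0
    apply hN'0
    rw [hNeq, h0, mul_zero]
  rw [hnum, hNeq, ldeg_mul (C_eq_zero.not.mpr T.A.hκ) (mul_ne_zero (C_eq_zero.not.mpr hs) hN0),
    ldeg_C, zero_add, ldeg_mul (C_eq_zero.not.mpr hs) hN0, ldeg_C, zero_add,
    ldeg_map_of_injective (RatFunc.algebraMap_injective F'), hNl]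

/-- ★ **`(T/S)|_{z=0}` for two companion terms of the same excess** (the summands
"`(T_{i,j}/T̃_{k−j,j})|_{z=0} = (ε^{-a}·U·V/(U·V) · P·Q/(P·Q))|_{z=0}`" of Claim 3.8): with
`T = num_T/den_T`, `S = num_S/den_S` (B4b's cleared polynomials), `(T/S)|_{z=0}` is
`[num_T · den_S]_ℓ / in(den_T · num_S)` with `ℓ = b + a′ = ldeg (den_T · num_S)` (transcendental
point: lowest degrees are the weights).
[cite: DuttaDwivediSaxena2022, Claim 3.8 proof, second displayed line (full version p0035 L938–939)] -/
theorem ExactTerm.Companion.gradeZero_div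
    (hinj : Function.Injective (algebraMap (MvPolynomial (Fin n) F) F'))
    {a b a' b' : ℕ} {T S : ExactTerm (RatFunc F') n}
    (hT : ExactTerm.Companion (ratFuncMap (algebraMap F F'))
      (fun m => algebraMap F' (RatFunc F') (algebraMap (MvPolynomial (Fin n) F) F' (X m))) a b T)
    (hS : ExactTerm.Companion (ratFuncMap (algebraMap F F'))
      (fun m => algebraMap F' (RatFunc F') (algebraMap (MvPolynomial (Fin n) F) F' (X m))) a' b' S)
    (hbal : a + b' = b + a') (hTw : T.WF) (hSw : S.WF) (hSn : S.ND) :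
    GradeZero (T.val / S.val)
      (algebraMap (MvPolynomial (Fin n) (RatFunc F')) (FractionRing (MvPolynomial (Fin n) (RatFunc F')))
          (homogeneousComponent (b + a') (T.numPoly * S.denPoly)) /
        algebraMap (MvPolynomial (Fin n) (RatFunc F')) (FractionRing (MvPolynomial (Fin n) (RatFunc F')))
          (initialForm (T.denPoly * S.numPoly))) := by
  have hQ0 : T.denPoly * S.numPoly ≠ 0 :=
    mul_ne_zero (T.denPoly_ne_zero hTw) (S.numPoly_ne_zero hSn)
  have hlQ : ldeg (T.denPoly * S.numPoly) = b + a' := by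
    rw [ldeg_mul (T.denPoly_ne_zero hTw) (S.numPoly_ne_zero hSn), hT.ldeg_denPoly hinj hTw,
      hS.ldeg_numPoly hinj hSn]
  have hY : T.val / S.val *
      algebraMap (MvPolynomial (Fin n) (RatFunc F')) (FractionRing (MvPolynomial (Fin n) (RatFunc F')))
        (T.denPoly * S.numPoly) =
      algebraMap (MvPolynomial (Fin n) (RatFunc F')) (FractionRing (MvPolynomial (Fin n) (RatFunc F')))
        (T.numPoly * S.denPoly) := by
    have h1 := algebraMap_frac_ne_zero (T.denPoly_ne_zero hTw)
    have h2 := algebraMap_frac_ne_zero (S.denPoly_ne_zero hSw)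
    have h3 := algebraMap_frac_ne_zero (S.numPoly_ne_zero hSn)
    rw [T.val_eq_numPoly_div_denPoly hTw, S.val_eq_numPoly_div_denPoly hSw, map_mul, map_mul]
    field_simp
  have hP : ∀ d : Fin n →₀ ℕ, d.degree < ldeg (T.denPoly * S.numPoly) →
      coeff d (T.numPoly * S.denPoly) = 0 := by
    rw [hlQ, ← hbal]
    obtain ⟨N', hN', hnum⟩ := hT.numPoly
    rw [hnum, mul_assoc]
    exact vanishing_C_mul _ (coeff_mul_eq_zero_of_vanishing hN'.vanishing hS.denPoly.vanishing)
  have h := gradeZero_of_model hQ0 hY hP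
  rwa [hlQ] at h

/-- The same with the numerator's initial form, for a NONDEGENERATE `T` (then
`ldeg (num_T · den_S) = ℓ` too): `(T/S)|_{z=0} = in(num_T)·in(den_S) / (in(den_T)·in(num_S))`.
[cite: DuttaDwivediSaxena2022, Claim 3.8 proof, second displayed line (full version p0035 L938–939)] -/
theorem ExactTerm.Companion.gradeZero_div_of_nd
    (hinj : Function.Injective (algebraMap (MvPolynomial (Fin n) F) F'))
    {a b a' b' : ℕ} {T S : ExactTerm (RatFunc F') n}
    (hT : ExactTerm.Companion (ratFuncMap (algebraMap F F'))
      (fun m => algebraMap F' (RatFunc F') (algebraMap (MvPolynomial (Fin n) F) F' (X m))) a b T)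
    (hS : ExactTerm.Companion (ratFuncMap (algebraMap F F'))
      (fun m => algebraMap F' (RatFunc F') (algebraMap (MvPolynomial (Fin n) F) F' (X m))) a' b' S)
    (hbal : a + b' = b + a') (hTw : T.WF) (hTn : T.ND) (hSw : S.WF) (hSn : S.ND) :
    GradeZero (T.val / S.val)
      (algebraMap (MvPolynomial (Fin n) (RatFunc F')) (FractionRing (MvPolynomial (Fin n) (RatFunc F')))
          (initialForm T.numPoly * initialForm S.denPoly) /
        algebraMap (MvPolynomial (Fin n) (RatFunc F')) (FractionRing (MvPolynomial (Fin n) (RatFunc F')))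
          (initialForm T.denPoly * initialForm S.numPoly)) := by
  have h := hT.gradeZero_div hinj hS hbal hTw hSw hSn
  have hlP : ldeg (T.numPoly * S.denPoly) = b + a' := by
    rw [ldeg_mul (T.numPoly_ne_zero hTn) (S.denPoly_ne_zero hSw), hT.ldeg_numPoly hinj hTn,
      hS.ldeg_denPoly hinj hSw, hbal]
  rwa [← hlP, ← initialForm, initialForm_mul, initialForm_mul] at h

/-- A DEGENERATE term (`𝒫 = 0`, value `0`) contributes `0` at `z = 0`.
[cite: DuttaDwivediSaxena2022, Claim 3.8 proof (full version p0035 L938–939)] -/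
theorem ExactTerm.gradeZero_div_of_not_nd {K : Type*} [Field K] {T S : ExactTerm K n} (hTw : T.WF)
    (hTn : ¬ T.ND) : GradeZero (T.val / S.val) 0 := by
  rw [(T.val_eq_zero_iff hTw).mpr hTn, zero_div]
  exact gradeZero_zero

end Transcendental

section FractionRingInst

variable {F : Type*} [Field F] {n : ℕ}

/-- ★★ `epsLim_gradeZero_stage` over THE field of record `F′ = Frac F[y₁,…,y_n]` of architecture
`(A′)` (injectivity of `F[y] → F′` discharged).
[cite: DuttaDwivediSaxena2022, Claim 3.8 with proof (full version p0035 L934–939)] -/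
theorem epsLim_gradeZero_stage_fractionRing
    {m e : ℕ} {G : Fin (m + 1) → ExactTerm (RatFunc (FractionRing (MvPolynomial (Fin n) F))) n}
    (hWF : ∀ i, (G i).WF) {i₀ : Fin (m + 1)} (hND : (G i₀).ND)
    (hcomp : StageComp (ratFuncMap (algebraMap F (FractionRing (MvPolynomial (Fin n) F))))
      (fun m => algebraMap (FractionRing (MvPolynomial (Fin n) F))
        (RatFunc (FractionRing (MvPolynomial (Fin n) F)))
        (algebraMap (MvPolynomial (Fin n) F) (FractionRing (MvPolynomial (Fin n) F)) (X m))) e G)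
    (lam : RatFunc (FractionRing (MvPolynomial (Fin n) F)))
    {r : FractionRing (MvPolynomial (Fin n) (FractionRing (MvPolynomial (Fin n) F)))}
    (hY : EpsLim (algebraMap (RatFunc (FractionRing (MvPolynomial (Fin n) F)))
      (FractionRing (MvPolynomial (Fin n) (RatFunc (FractionRing (MvPolynomial (Fin n) F))))) lam *
      ((∑ i, (G i).val) / (G i₀).val)) r)
    {w : FractionRing (MvPolynomial (Fin n) (RatFunc (FractionRing (MvPolynomial (Fin n) F))))}
    {w₀ : FractionRing (MvPolynomial (Fin n) (FractionRing (MvPolynomial (Fin n) F)))}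
    (hw : GradeZero (algebraMap (RatFunc (FractionRing (MvPolynomial (Fin n) F)))
      (FractionRing (MvPolynomial (Fin n) (RatFunc (FractionRing (MvPolynomial (Fin n) F))))) lam *
      ((∑ i, (G i).val) / (G i₀).val)) w)
    (hw₀ : GradeZero r w₀) : EpsLim w w₀ :=
  epsLim_gradeZero_stage (IsFractionRing.injective _ _) hWF hND hcomp lam hY hw hw₀

end FractionRingInst

end DDS2021

end Literature.Computability.AlgebraicComplexity

end
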